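import Literature.NumberTheory.Sieve.GoldbachLinnikRomanovConstant
import Literature.NumberTheory.Sieve.GoldbachLinnikDirectCertified
import Literature.NumberTheory.LFunctions.MertensFromChebyshev
import Literature.NumberTheory.LFunctions.MertensElementary
import HarnessLib

/-!
# A kernel-certified upper bound for Romanov's constant: `R₀ = ∑_t f₁(t)/ord_t 2 ≤ 2.071`

Topic `Literature/NumberTheory/Sieve`; sequel to `GoldbachLinnikRomanovLemma.lean` (Romanov's lemma, qualitative) and
`GoldbachLinnikRomanovConstant.lean` (`romanovConst = R₀`, `hR ⇔ R₀ ≤ R`) (cell `pub-lg7`, seat 5).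
**NOT A ROUTE TO GOLDBACH; `K = 7` is NOT claimed (print record `K = 8`); nothing in-house is cited as fact.**

`GoldbachLinnikRomanovConstant` records the printed value `1.936 < R₀ < 1.94` (Pintz–Ruzsa I (8.14), from
Khalfalah–Pintz) only as a hypothesis `hR₀ : romanovConst ≤ 1.94`.  This file proves an unconditional, kernel-checked
bound `romanovConst_le : romanovConst ≤ 2.071` (standard axioms only; every numerical input is re-verified by
`decide +kernel` inside this file).  The value `2.071` is weaker than print but is what the certified large-deviation
assembly at `K = 9` consumes (any `R₀ ≤ 2.2142` suffices there, cf. Heath-Brown–Puchta §5 (41): `C₂ ≤ 2.2141`).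

## The argument (Heath-Brown–Puchta §5 (41), Nathanson Lemma 7.8, made explicit)

With `E(x) = ∑_{t : ord_t 2 ≤ x} f₁(t)` (`f₁(t) = ∏_{p ∣ t} (p−2)⁻¹` on odd square-free `t`), partial summation gives
`∑_{t<X} f₁(t)/ord_t 2 ≤ ∑_{x ≤ X} U(x)/(x(x+1)) + U(X)/(X+1)` for any majorant `E ≤ U` (§1).  Three majorants:

* HEAD `x ≤ 60` (§2, §9): `E(x) ≤ Φ_x(A) := ∑_{S ⊆ A, lcm_{p∈S} ord_p 2 ≤ x} ∏_{p∈S}(p−2)⁻¹` whenever `A` contains every prime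
  factor of `D(x) = ∏_{k≤x}(2^k−1)`; `A` = 87 certified primes (primality by trial division, `ord_p 2` by the order
  certificate of `GoldbachLinnikDirectMeanCert`) plus the prime factors of two rough cofactors (`< 16384^{ν+1}`, no factor
  `< 16384`, so at most `ν` primes each, `ν = 3, 2`), whose order constraint is dropped at the cost `(16383/16382)^5`;
  `Φ_x` over the certified primes is the pruned subset recursion `headRec`, evaluated by the kernel in `ℚ`.
* TABLE `61 ≤ x ≤ 255` (§4, §5): `E(x) ≤ H(D(x)) ≤ C₀⁻¹ ∏_{p ∣ D(x)} p/(p−1) ≤ C₀⁻¹ (∏_{3≤p≤2^K−1} p/(p−1)) (1+1/(2^K−1))^r`,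
  `r = ⌊x(x+1)/2/K⌋` (`D(x) ≤ 2^{x(x+1)/2}` has at most `r` prime factors `≥ 2^K`), `C₀ ≥ 0.65828`
  (`twinPrimeConst_ge`), the prime products bounded by kernel-evaluated trial-division supersets (`ppQ`, chunks of ≤ 4096).
* FAR `x ≥ 256` (§6, §10): the same with `K = 2j+1` on `x ∈ [2^j, 2^{j+1})`, the primes in `(2^15, 2^K]` handled by
  `p/(p−1) ≤ e^{1/(p−1)}` and the tree's explicit Mertens window bound `MertensChebyshev.sum_inv_primes_window_le`
  (`∑_{y<p≤x} 1/p ≤ 1.0722 log(log x/log y) + 0.133/log y + 12/√y`, `y = 2^15 ≥ e^{10}`), Bernoulli for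
  `(K/15)^{1.0722}` (Mathlib's `Real.exp_bound_div_one_sub_of_interval`, `e^x ≤ 1/(1−x)` on `[0,1)`), and the dyadic sums `∑_{j≥8} (a + bj + cj²)/2^{j+1}`
  in closed form.

Numerically: head+table `≤ 1.988156`, far `≤ 0.082039`, total `≤ 2.0702 ≤ 2.071`.

Main statements: `sum_range_fq_div_ordTwo_le_of_majorant` (partial summation with a majorant),
`sum_filter_ordTwo_le_Phi` + `headRec_eq_Phi` (the exact head), `hFactor_le_inv_twinPrimeConst_mul`,
`prod_primeFactors_div_pred_le`, `prod_large_primes_le`, `sum_range_fq_div_ordTwo_le_cert` (`∑_{t<X} ≤ 2.071` for all `X`),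
`romanovConst_le`.

## References

* D. R. Heath-Brown, J.-C. Puchta, *Integers represented as a sum of primes and powers of two*, Asian J. Math. 6 (2002)
  535–565: §5 "A mean square estimate", eq. (41) (the method: exact head over order classes + `H(D)`-tail; their `HEAD(20) = 1.6659`, `C₂ ≤ 2.2141`).
  [HeathbrownPuchta2002]
* M. B. Nathanson, *Additive Number Theory: The Classical Bases*, GTM 164, Springer 1996: Lemma 7.8 (partial summation for
  Romanov's sum). [Nathanson1996]
* J. Pintz, I. Z. Ruzsa, *On Linnik's approximation to Goldbach's problem, I*, Acta Arith. 109 (2003) 169–194: (8.13)–(8.14)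
  (`R₀`, printed `1.936 < R₀ < 1.94`). [PintzRuzsa2003]
* K. Ford, *Vinogradov's integral and bounds for the Riemann zeta function*, Proc. LMS 85 (2002): §2 (the shape of the
  explicit `∑ 1/p` window bound used by `MertensFromChebyshev`). [Ford2002]
-/

open Finset Filter

namespace Literature.NumberTheory.Sieve

namespace GoldbachLinnik

open SingularSeriesMean Literature.NumberTheory.Sieve.Romanov


/-! ### §1 Partial summation with a majorant -/

/-- **Partial summation with a majorant** (Nathanson Lemma 7.8; HBP §5): if
`E_X(x) = ∑_{t<X, ξ(t) ≤ x} f₁(t) ≤ U(x)` for `1 ≤ x ≤ X`, then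
`∑_{t<X} f₁(t)/ξ(t) ≤ ∑_{x=1}^{X} U(x)/(x(x+1)) + U(X)/(X+1)`. [cite: Nathanson1996, Lemma 7.8] -/
theorem sum_range_fq_div_ordTwo_le_of_majorant (U : ℕ → ℝ) {X : ℕ} (hX : 1 ≤ X)
    (hU : ∀ x ∈ Icc 1 X, ∑ t ∈ (Finset.range X).filter (fun t => ordTwo t ≤ x), fq 1 t ≤ U x) :
    ∑ t ∈ Finset.range X, fq 1 t / (ordTwo t : ℝ) ≤
      ∑ x ∈ Icc 1 X, U x / ((x : ℝ) * (x + 1)) + U X / ((X : ℝ) + 1) := by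
  set w : ℕ → ℝ := fun t =>
    ∑ x ∈ (Icc 1 X).filter (fun x => ordTwo t ≤ x), 1 / ((x : ℝ) * (x + 1)) + 1 / ((X : ℝ) + 1) with hw
  have hterm : ∀ t ∈ Finset.range X, fq 1 t / (ordTwo t : ℝ) ≤ fq 1 t * w t := by
    intro t ht
    by_cases h0 : fq 1 t = 0
    · rw [h0, zero_div, zero_mul]
    · have hodd := odd_of_fq_one_ne_zero h0
      have htX : ordTwo t ≤ X :=
        (ordTwo_le_self (by rintro rfl; exact (Nat.not_odd_zero hodd).elim)).trans (Finset.mem_range.1 ht).le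
      have hwt : w t = 1 / (ordTwo t : ℝ) := by
        simp only [hw]
        exact (inv_ordTwo_eq hodd htX).symm
      rw [hwt, div_eq_mul_one_div]
  have hexch : ∑ t ∈ Finset.range X, fq 1 t * w t =
      ∑ x ∈ Icc 1 X, (1 / ((x : ℝ) * (x + 1))) * ∑ t ∈ (Finset.range X).filter (fun t => ordTwo t ≤ x), fq 1 t
        + (1 / ((X : ℝ) + 1)) * ∑ t ∈ Finset.range X, fq 1 t := by
    have h1 : ∀ t, fq 1 t * w t =
        (∑ x ∈ Icc 1 X, if ordTwo t ≤ x then fq 1 t * (1 / ((x : ℝ) * (x + 1))) else 0) +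
          (1 / ((X : ℝ) + 1)) * fq 1 t := by
      intro t
      simp only [hw, mul_add, Finset.mul_sum, Finset.sum_filter, mul_ite, mul_zero]
      ring
    rw [Finset.sum_congr rfl (fun t _ => h1 t), Finset.sum_add_distrib, Finset.sum_comm, ← Finset.mul_sum]
    congr 1
    refine Finset.sum_congr rfl fun x _ => ?_
    rw [Finset.mul_sum, Finset.sum_filter]
    refine Finset.sum_congr rfl fun t _ => ?_
    split_ifs <;> ring
  have hlast : ∑ t ∈ Finset.range X, fq 1 t =
      ∑ t ∈ (Finset.range X).filter (fun t => ordTwo t ≤ X), fq 1 t := by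
    rw [← Finset.sum_filter_add_sum_filter_not (Finset.range X) (fun t => ordTwo t ≤ X), add_eq_left]
    refine Finset.sum_eq_zero fun t ht => ?_
    rw [Finset.mem_filter] at ht
    by_contra h0
    have hodd := odd_of_fq_one_ne_zero h0
    exact ht.2 ((ordTwo_le_self (by rintro rfl; exact (Nat.not_odd_zero hodd).elim)).trans
      (Finset.mem_range.1 ht.1).le)
  have hA : ∀ x ∈ Icc 1 X, (1 / ((x : ℝ) * (x + 1))) *
      ∑ t ∈ (Finset.range X).filter (fun t => ordTwo t ≤ x), fq 1 t ≤ U x / ((x : ℝ) * (x + 1)) := by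
    intro x hx
    have hx1 : (1 : ℝ) ≤ x := by exact_mod_cast (Finset.mem_Icc.1 hx).1
    rw [div_eq_mul_one_div (U x), mul_comm (U x)]
    exact mul_le_mul_of_nonneg_left (hU x hx) (by positivity)
  have hB : (1 / ((X : ℝ) + 1)) * ∑ t ∈ Finset.range X, fq 1 t ≤ U X / ((X : ℝ) + 1) := by
    rw [hlast, div_eq_mul_one_div (U X), mul_comm (U X)]
    exact mul_le_mul_of_nonneg_left (hU X (Finset.mem_Icc.2 ⟨hX, le_rfl⟩)) (by positivity)
  calc ∑ t ∈ Finset.range X, fq 1 t / (ordTwo t : ℝ) ≤ ∑ t ∈ Finset.range X, fq 1 t * w t :=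
        Finset.sum_le_sum hterm
    _ = _ := hexch
    _ ≤ ∑ x ∈ Icc 1 X, U x / ((x : ℝ) * (x + 1)) + U X / ((X : ℝ) + 1) :=
        add_le_add (Finset.sum_le_sum hA) hB

/-- `E(x) ≤ H(D(x))`: `∑_{t ∈ s, ξ(t) ≤ x} f₁(t) ≤ ∑_{t ∣ D(x)} f₁(t) = ∏_{p ∣ D(x)} (p−1)/(p−2)`,
`D(x) = ∏_{k ≤ x}(2^k − 1)`. [cite: Nathanson1996, Lemma 7.8] -/
theorem sum_filter_ordTwo_le_hFactor (s : Finset ℕ) (x : ℕ) :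
    ∑ t ∈ s with ordTwo t ≤ x, fq 1 t ≤ hFactor (romanovD x) := by
  have hP0 := romanovD_ne_zero x
  rw [← sum_divisors_fq_one hP0, ← Finset.sum_filter_ne_zero (s.filter fun t => ordTwo t ≤ x)]
  refine Finset.sum_le_sum_of_subset_of_nonneg (fun t ht => ?_) fun t _ _ => fq_nonneg 1 t
  rw [Finset.mem_filter, Finset.mem_filter] at ht
  exact Nat.mem_divisors.2 ⟨dvd_romanovD_of_ordTwo_le (odd_of_fq_one_ne_zero ht.2) ht.1.2, hP0⟩

/-! ### §2 The exact head: order classes of sets of odd primes -/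

/-- `w(S) = ∏_{p ∈ S} 1/(p − 2)`. [folklore] -/
noncomputable def wt (S : Finset ℕ) : ℝ := ∏ p ∈ S, 1 / ((p : ℝ) - 2)

/-- `w(S) ≥ 0` for `S ⊆ {p > 2}`. [folklore] -/
theorem wt_nonneg {S : Finset ℕ} (hS : ∀ p ∈ S, 2 < p) : 0 ≤ wt S :=
  Finset.prod_nonneg fun p hp => by
    have : (2 : ℝ) < p := by exact_mod_cast hS p hp
    have : 0 < (p : ℝ) - 2 := by linarith
    positivity

/-- A finite set of odd primes. [folklore] -/
def PrimeSet (A : Finset ℕ) : Prop := ∀ p ∈ A, p.Prime ∧ 2 < p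

/-- Odd primes have positive `ord_p 2`, so `lcm_{p ∈ S} ord_p 2 > 0`. [folklore] -/
theorem lcm_ordTwo_pos {S : Finset ℕ} (hS : PrimeSet S) : 0 < S.lcm ordTwo := by
  refine Nat.pos_of_ne_zero (Finset.lcm_ne_zero_iff.2 fun p hp => ?_)
  have h := hS p hp
  exact (ordTwo_pos (h.1.odd_of_ne_two (by have := h.2; omega))).ne'

/-- `Φ_x(A, L) = ∑_{S ⊆ A : lcm(L, lcm_{p∈S} ord_p 2) ≤ x} w(S)` — the total weight of the square-free
products of primes of `A` whose order (joined with `L`) is at most `x`. [folklore] -/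
noncomputable def Phi (x : ℕ) (A : Finset ℕ) (L : ℕ) : ℝ :=
  ∑ S ∈ A.powerset, if Nat.lcm L (S.lcm ordTwo) ≤ x then wt S else 0

/-- `Φ ≥ 0`. [folklore] -/
theorem Phi_nonneg {x : ℕ} {A : Finset ℕ} (hA : PrimeSet A) (L : ℕ) : 0 ≤ Phi x A L := by
  refine Finset.sum_nonneg fun S hS => ?_
  have hSA : S ⊆ A := Finset.mem_powerset.1 hS
  split_ifs
  · exact wt_nonneg fun p hp => (hA p (hSA hp)).2
  · exact le_rfl

/-- `Φ` is antitone in `L` for divisibility. [folklore] -/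
theorem Phi_anti {x : ℕ} {A : Finset ℕ} (hA : PrimeSet A) {L L' : ℕ} (hL' : L' ≠ 0) (h : L ∣ L') :
    Phi x A L' ≤ Phi x A L := by
  refine Finset.sum_le_sum fun S hS => ?_
  have hSA : S ⊆ A := Finset.mem_powerset.1 hS
  have hw : 0 ≤ wt S := wt_nonneg fun p hp => (hA p (hSA hp)).2
  have hM : 0 < S.lcm ordTwo := lcm_ordTwo_pos fun p hp => hA p (hSA hp)
  by_cases h1 : Nat.lcm L' (S.lcm ordTwo) ≤ x
  · have h2 : Nat.lcm L (S.lcm ordTwo) ≤ x := by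
      refine le_trans (Nat.le_of_dvd (Nat.lcm_pos (Nat.pos_of_ne_zero hL') hM) ?_) h1
      exact Nat.lcm_dvd (h.trans (Nat.dvd_lcm_left _ _)) (Nat.dvd_lcm_right _ _)
    rw [if_pos h1, if_pos h2]
  · rw [if_neg h1]
    split_ifs
    · exact hw
    · exact le_rfl

/-- Pruning: `Φ_x(A, L) = 0` once `L > x`. [folklore] -/
theorem Phi_eq_zero_of_lt {x : ℕ} {A : Finset ℕ} (hA : PrimeSet A) {L : ℕ} (hxL : x < L) :
    Phi x A L = 0 := by
  refine Finset.sum_eq_zero fun S hS => ?_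
  have hSA : S ⊆ A := Finset.mem_powerset.1 hS
  have hM : 0 < S.lcm ordTwo := lcm_ordTwo_pos fun p hp => hA p (hSA hp)
  have : x < Nat.lcm L (S.lcm ordTwo) :=
    lt_of_lt_of_le hxL (Nat.le_of_dvd (Nat.lcm_pos (by omega) hM) (Nat.dvd_lcm_left _ _))
  rw [if_neg (not_le.2 this)]

/-- `Φ_x(∅, L) = [L ≤ x]`. [folklore] -/
theorem Phi_empty (x L : ℕ) : Phi x ∅ L = if L ≤ x then 1 else 0 := by
  simp [Phi, wt]

/-- The GCD-monoid `lcm` on `ℕ` is `Nat.lcm`. [folklore] -/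
theorem gcdMonoid_lcm_nat (a b : ℕ) : GCDMonoid.lcm a b = Nat.lcm a b := rfl

/-- Recursion: `Φ_x(A ∪ {q}, L) = Φ_x(A, L) + (q−2)⁻¹ Φ_x(A, lcm(L, ord_q 2))` for `q ∉ A`. [folklore] -/
theorem Phi_insert {x : ℕ} {A : Finset ℕ} {q : ℕ} (hq : q ∉ A) (L : ℕ) :
    Phi x (insert q A) L = Phi x A L + 1 / ((q : ℝ) - 2) * Phi x A (Nat.lcm L (ordTwo q)) := by
  unfold Phi
  rw [Finset.sum_powerset_insert hq, Finset.mul_sum]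
  congr 1
  refine Finset.sum_congr rfl fun S hS => ?_
  have hqS : q ∉ S := fun h => hq (Finset.mem_powerset.1 hS h)
  have hwt : wt (insert q S) = 1 / ((q : ℝ) - 2) * wt S := by
    unfold wt
    rw [Finset.prod_insert hqS]
  have hlcm : Nat.lcm L ((insert q S).lcm ordTwo) = Nat.lcm (Nat.lcm L (ordTwo q)) (S.lcm ordTwo) := by
    rw [Finset.lcm_insert, gcdMonoid_lcm_nat, Nat.lcm_assoc]
  rw [hlcm, hwt]
  split_ifs <;> simp

/-- For disjoint-or-not sets of odd primes: `Φ_x(C ∪ R, L) ≤ ∏_{q ∈ R}(1 + (q−2)⁻¹) · Φ_x(C, L)`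
(drop the order constraint for the primes of `R`). [folklore] -/
theorem Phi_union_le {x : ℕ} {C : Finset ℕ} (hC : PrimeSet C) (R : Finset ℕ) (hR : PrimeSet R) :
    ∀ L : ℕ, L ≠ 0 → Phi x (C ∪ R) L ≤ (∏ q ∈ R, (1 + 1 / ((q : ℝ) - 2))) * Phi x C L := by
  classical
  induction R using Finset.induction_on with
  | empty => intro L _; simp
  | insert q R hqR ih =>
    intro L hL
    have hq := hR q (Finset.mem_insert_self q R)
    have hR' : PrimeSet R := fun p hp => hR p (Finset.mem_insert_of_mem hp)
    have hkq : 0 ≤ 1 / ((q : ℝ) - 2) := by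
      have : (2 : ℝ) < q := by exact_mod_cast hq.2
      have : 0 < (q : ℝ) - 2 := by linarith
      positivity
    have hCR : PrimeSet (C ∪ R) := by
      intro p hp
      rcases Finset.mem_union.1 hp with h | h
      · exact hC p h
      · exact hR' p h
    have hprod0 : 0 ≤ ∏ q ∈ R, (1 + 1 / ((q : ℝ) - 2)) :=
      Finset.prod_nonneg fun p hp => by
        have : (2 : ℝ) < p := by exact_mod_cast (hR' p hp).2
        have : 0 < (p : ℝ) - 2 := by linarith
        positivity
    rw [Finset.prod_insert hqR, Finset.union_insert]
    by_cases hqm : q ∈ C ∪ R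
    · rw [Finset.insert_eq_of_mem hqm]
      calc Phi x (C ∪ R) L ≤ (∏ q ∈ R, (1 + 1 / ((q : ℝ) - 2))) * Phi x C L := ih hR' L hL
        _ ≤ (1 + 1 / ((q : ℝ) - 2)) * ((∏ q ∈ R, (1 + 1 / ((q : ℝ) - 2))) * Phi x C L) := by
            refine le_mul_of_one_le_left (mul_nonneg hprod0 (Phi_nonneg hC L)) (by linarith)
        _ = _ := by ring
    · rw [Phi_insert hqm]
      have hlcm0 : Nat.lcm L (ordTwo q) ≠ 0 :=
        (Nat.lcm_pos (Nat.pos_of_ne_zero hL) (ordTwo_pos (hq.1.odd_of_ne_two (by have := hq.2; omega)))).ne'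
      have h1 : Phi x (C ∪ R) (Nat.lcm L (ordTwo q)) ≤ Phi x (C ∪ R) L :=
        Phi_anti hCR hlcm0 (Nat.dvd_lcm_left _ _)
      have h2 := ih hR' L hL
      calc Phi x (C ∪ R) L + 1 / ((q : ℝ) - 2) * Phi x (C ∪ R) (Nat.lcm L (ordTwo q))
          ≤ Phi x (C ∪ R) L + 1 / ((q : ℝ) - 2) * Phi x (C ∪ R) L := by
            have := mul_le_mul_of_nonneg_left h1 hkq; linarith
        _ = (1 + 1 / ((q : ℝ) - 2)) * Phi x (C ∪ R) L := by ring
        _ ≤ (1 + 1 / ((q : ℝ) - 2)) * ((∏ q ∈ R, (1 + 1 / ((q : ℝ) - 2))) * Phi x C L) :=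
            mul_le_mul_of_nonneg_left h2 (by linarith)
        _ = _ := by ring

/-- **The order-class embedding**: if every prime factor of every odd square-free `t` with
`ξ(t) ≤ x` lies in `A`, then `E(x) = ∑_{t ∈ s, ξ(t) ≤ x} f₁(t) ≤ Φ_x(A, 1)` (`t ↦` its set of prime
factors is injective on square-free `t`, `f₁(t) = w(primes of t)`, and `lcm_{p ∣ t} ord_p 2 ∣ ξ(t) ≤ x`).
[cite: HeathbrownPuchta2002, §5 (41)] -/
theorem sum_filter_ordTwo_le_Phi (s : Finset ℕ) {x : ℕ} {A : Finset ℕ} (hA : PrimeSet A)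
    (hfac : ∀ t : ℕ, t ≠ 0 → Odd t → ordTwo t ≤ x → t.primeFactors ⊆ A) :
    ∑ t ∈ s with ordTwo t ≤ x, fq 1 t ≤ Phi x A 1 := by
  classical
  set T := (s.filter fun t => ordTwo t ≤ x).filter (fun t => fq 1 t ≠ 0) with hT
  have hmemT : ∀ t ∈ T, ordTwo t ≤ x ∧ Squarefree t ∧ Odd t ∧ fq 1 t = wt t.primeFactors := by
    intro t ht
    simp only [hT, Finset.mem_filter] at ht
    obtain ⟨⟨-, hox⟩, hne⟩ := ht
    have hodd := odd_of_fq_one_ne_zero hne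
    rw [fq_apply] at hne ⊢
    by_cases hc : Squarefree t ∧ Nat.Coprime t (2 * 1)
    · rw [if_pos hc]; exact ⟨hox, hc.1, hodd, rfl⟩
    · exact absurd (if_neg hc) hne
  have hT0 : ∀ t ∈ T, t ≠ 0 := by
    intro t ht h0
    have := (hmemT t ht).2.2.1
    rw [h0] at this
    exact Nat.not_odd_zero this
  set G : Finset ℕ → ℝ := fun S => if Nat.lcm 1 (S.lcm ordTwo) ≤ x then wt S else 0 with hG
  have hG0 : ∀ S ∈ A.powerset, 0 ≤ G S := by
    intro S hS
    have hSA := Finset.mem_powerset.1 hS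
    simp only [hG]
    split_ifs
    · exact wt_nonneg fun p hp => (hA p (hSA hp)).2
    · exact le_rfl
  calc ∑ t ∈ s with ordTwo t ≤ x, fq 1 t = ∑ t ∈ T, fq 1 t := (Finset.sum_filter_ne_zero _).symm
    _ = ∑ t ∈ T, G t.primeFactors := by
        refine Finset.sum_congr rfl fun t ht => ?_
        obtain ⟨hox, -, hodd, hft⟩ := hmemT t ht
        have hM : t.primeFactors.lcm ordTwo ≤ x := by
          refine le_trans (Nat.le_of_dvd (ordTwo_pos hodd) (Finset.lcm_dvd fun p hp => ?_)) hox
          exact ordTwo_dvd_ordTwo_of_dvd (Nat.dvd_of_mem_primeFactors hp)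
        simp only [hG, Nat.lcm_one_left, if_pos hM, hft]
    _ = ∑ S ∈ T.image Nat.primeFactors, G S := by
        rw [Finset.sum_image]
        intro t₁ h₁ t₂ h₂ heq
        calc t₁ = ∏ p ∈ t₁.primeFactors, p := (Nat.prod_primeFactors_of_squarefree (hmemT t₁ h₁).2.1).symm
          _ = ∏ p ∈ t₂.primeFactors, p := by rw [heq]
          _ = t₂ := Nat.prod_primeFactors_of_squarefree (hmemT t₂ h₂).2.1
    _ ≤ ∑ S ∈ A.powerset, G S := by
        refine Finset.sum_le_sum_of_subset_of_nonneg (fun S hS => ?_) fun S hS _ => hG0 S hS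
        rw [Finset.mem_image] at hS
        obtain ⟨t, ht, rfl⟩ := hS
        obtain ⟨hox, -, hodd, -⟩ := hmemT t ht
        exact Finset.mem_powerset.2 (hfac t (hT0 t ht) hodd hox)
    _ = Phi x A 1 := rfl

/-! ### §3 Kernel-evaluable certificates: trial division, orders, the pruned recursion -/

/-- `noOddDiv a n`: no odd `d = 2i + 3`, `i < n`, divides `a` (a `List.range` loop, kernel-friendly). [folklore] -/
def noOddDiv (a n : ℕ) : Bool := (List.range n).all fun i => !decide (a % (2 * i + 3) = 0)

/-- Soundness of `noOddDiv`: no odd `d ∈ [3, 2n+3)` divides `a`. [folklore] -/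
theorem noOddDiv_sound {a n : ℕ} (h : noOddDiv a n = true) :
    ∀ d, Odd d → 3 ≤ d → d < 2 * n + 3 → ¬ d ∣ a := by
  simp only [noOddDiv, List.all_eq_true, List.mem_range, Bool.not_eq_true', decide_eq_false_iff_not] at h
  intro d hodd h3 hlt hdvd
  obtain ⟨i, rfl⟩ := hodd
  have hi : i - 1 < n := by omega
  have := h (i - 1) hi
  rw [show 2 * (i - 1) + 3 = 2 * i + 1 by omega] at this
  exact this (Nat.mod_eq_zero_of_dvd hdvd)

/-- Primality certificate by trial division: `a` odd, `2 ≤ a < b²`, no odd divisor `d` with `3 ≤ d ≤ 2⌊(b−1)/2⌋+1`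
(so none below `b`). [folklore] -/
def primeCert (a b : ℕ) : Bool :=
  decide (2 ≤ a) && decide (a % 2 = 1) && decide (a < b * b) && noOddDiv a ((b - 1) / 2)

/-- Soundness of `primeCert`. [folklore] -/
theorem prime_of_primeCert {a b : ℕ} (h : primeCert a b = true) : a.Prime := by
  simp only [primeCert, Bool.and_eq_true, decide_eq_true_eq] at h
  obtain ⟨⟨⟨ha2, hodd⟩, hab⟩, hnd⟩ := h
  rw [Nat.prime_def_le_sqrt]
  refine ⟨ha2, fun m hm2 hm hdvd => ?_⟩
  have hmm : m * m ≤ a := Nat.le_sqrt.1 hm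
  have hmb : m < b := by
    by_contra hge
    push Not at hge
    have : b * b ≤ m * m := Nat.mul_le_mul hge hge
    omega
  rcases Nat.even_or_odd m with hev | hod
  · have h2 : 2 ∣ a := (even_iff_two_dvd.1 hev).trans hdvd
    omega
  · have h3 : 3 ≤ m := by obtain ⟨i, rfl⟩ := hod; omega
    exact noOddDiv_sound hnd m hod h3 (by omega) hdvd

/-- Roughness certificate: `F` odd, `0 < F < 16384^{ν+1}`, no odd divisor in `[3, 16385)`. [folklore] -/
def roughCert (F ν : ℕ) : Bool :=
  decide (0 < F) && decide (F % 2 = 1) && decide (F < 16384 ^ (ν + 1)) && noOddDiv F 8191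

/-- A rough `F` is positive, has all prime factors `≥ 16384`, hence at most `ν` of them. [folklore] -/
theorem roughCert_sound {F ν : ℕ} (h : roughCert F ν = true) :
    0 < F ∧ (∀ q ∈ F.primeFactors, 16384 ≤ q) ∧ F.primeFactors.card ≤ ν := by
  simp only [roughCert, Bool.and_eq_true, decide_eq_true_eq] at h
  obtain ⟨⟨⟨hF0, hodd⟩, hFlt⟩, hnd⟩ := h
  have hbig : ∀ q ∈ F.primeFactors, 16384 ≤ q := by
    intro q hq
    have hqP := Nat.prime_of_mem_primeFactors hq
    have hqd := Nat.dvd_of_mem_primeFactors hq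
    by_contra hlt
    push Not at hlt
    rcases hqP.eq_two_or_odd' with rfl | hqodd
    · omega
    · have h3 : 3 ≤ q := by
        have := hqP.two_le
        obtain ⟨i, rfl⟩ := hqodd; omega
      exact noOddDiv_sound hnd q hqodd h3 (by omega) hqd
  refine ⟨hF0, hbig, ?_⟩
  have h1 : 16384 ^ F.primeFactors.card ≤ F := by
    calc 16384 ^ F.primeFactors.card ≤ ∏ q ∈ F.primeFactors, q :=
          Finset.pow_card_le_prod _ _ _ hbig
      _ ≤ F := Nat.le_of_dvd hF0 (Nat.prod_primeFactors_dvd F)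
  have h2 : 16384 ^ F.primeFactors.card < 16384 ^ (ν + 1) := lt_of_le_of_lt h1 hFlt
  have := (Nat.pow_lt_pow_iff_right (by norm_num)).1 h2
  omega

/-- The pruned subset recursion over certified primes `(p, ord_p 2, _)`:
`headRec x l L = ∑_{S ⊆ l : lcm(L, ord S) ≤ x} ∏_{p ∈ S} (p−2)⁻¹` (exact, in `ℚ`). [folklore] -/
def headRec (x : ℕ) : List (ℕ × ℕ × ℕ) → ℕ → ℚ
  | [], L => if L ≤ x then 1 else 0
  | (p, e, _) :: l, L =>
      if x < L then 0
      else if x < e then headRec x l L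
      else headRec x l L + 1 / ((p : ℚ) - 2) * headRec x l (Nat.lcm L e)

/-- A certified prime list: every entry `(p, e, b)` has `p` prime, `p > 2`, `ord_p 2 = e`. [folklore] -/
def CertPrimes (l : List (ℕ × ℕ × ℕ)) : Prop := ∀ t ∈ l, t.1.Prime ∧ 2 < t.1 ∧ ordTwo t.1 = t.2.1

/-- The set of primes of a certified list is a `PrimeSet`. [folklore] -/
theorem primeSet_of_certPrimes {l : List (ℕ × ℕ × ℕ)} (hl : CertPrimes l) :
    PrimeSet (l.map Prod.fst).toFinset := by
  intro q hq
  rw [List.mem_toFinset, List.mem_map] at hq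
  obtain ⟨t, ht, rfl⟩ := hq
  exact ⟨(hl t ht).1, (hl t ht).2.1⟩

/-- **The recursion computes `Φ`**: `headRec x l L = Φ_x(primes of l, L)` for a certified, duplicate-free
list and `L ≠ 0`. [folklore] -/
theorem headRec_eq_Phi (x : ℕ) : ∀ (l : List (ℕ × ℕ × ℕ)), CertPrimes l → (l.map Prod.fst).Nodup →
    ∀ L : ℕ, L ≠ 0 → ((headRec x l L : ℚ) : ℝ) = Phi x (l.map Prod.fst).toFinset L
  | [], _, _, L, hL => by
      simp only [headRec, List.map_nil, List.toFinset_nil, Phi_empty]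
      split_ifs <;> simp
  | (p, e, b) :: l, hl, hnd, L, hL => by
      obtain ⟨hpP, hp2, hpe⟩ := hl (p, e, b) (by simp)
      have hl' : CertPrimes l := fun t ht => hl t (List.mem_cons_of_mem _ ht)
      rw [List.map_cons, List.nodup_cons] at hnd
      obtain ⟨hpl, hnd'⟩ := hnd
      have hA : PrimeSet (l.map Prod.fst).toFinset := primeSet_of_certPrimes hl'
      have hpA : p ∉ (l.map Prod.fst).toFinset := by rwa [List.mem_toFinset]
      have he0 : 0 < e := by
        have : ordTwo p = e := hpe
        rw [← this]
        exact ordTwo_pos (hpP.odd_of_ne_two (by omega))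
      have hL0 : 0 < L := Nat.pos_of_ne_zero hL
      have hLe : Nat.lcm L e ≠ 0 := (Nat.lcm_pos hL0 he0).ne'
      simp only [List.map_cons, List.toFinset_cons]
      rw [Phi_insert hpA, show ordTwo p = e from hpe]
      simp only [headRec]
      by_cases hxL : x < L
      · rw [if_pos hxL, Phi_eq_zero_of_lt hA hxL, Phi_eq_zero_of_lt hA (lt_of_lt_of_le hxL
          (Nat.le_of_dvd (Nat.lcm_pos hL0 he0) (Nat.dvd_lcm_left _ _)))]
        simp
      · rw [if_neg hxL]
        by_cases hxe : x < e
        · rw [if_pos hxe, headRec_eq_Phi x l hl' hnd' L hL, Phi_eq_zero_of_lt hA (lt_of_lt_of_le hxe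
            (Nat.le_of_dvd (Nat.lcm_pos hL0 he0) (Nat.dvd_lcm_right _ _)))]
          simp
        · rw [if_neg hxe]
          push_cast
          rw [headRec_eq_Phi x l hl' hnd' L hL, headRec_eq_Phi x l hl' hnd' (Nat.lcm L e) hLe]

/-- Certificate check for a prime list: `primeCert`, `p > 2` and the order certificate of
`GoldbachLinnikDirectMeanCert` (`ord2Cert`). [folklore] -/
def certListOK (l : List (ℕ × ℕ × ℕ)) : Bool :=
  l.all fun t => primeCert t.1 t.2.2 && decide (2 < t.1) && ord2Cert t.1 t.2.1

/-- Soundness of `certListOK`. [folklore] -/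
theorem certPrimes_of_certListOK {l : List (ℕ × ℕ × ℕ)} (h : certListOK l = true) : CertPrimes l := by
  intro t ht
  simp only [certListOK, List.all_eq_true, Bool.and_eq_true, decide_eq_true_eq] at h
  obtain ⟨⟨h1, h2⟩, h3⟩ := h t ht
  exact ⟨prime_of_primeCert h1, h2, ord2_eq_of_cert h3⟩

/-! ### §4 The tail: `H(D(x)) ≤ C₀⁻¹ · ∏_{p ∣ D(x), p ≤ y} p/(p−1) · (1 + 1/y)^r` -/

/-- `∑_{k=1}^{x} k = x(x+1)/2`. [folklore] -/
theorem sum_Icc_id_eq (x : ℕ) : ∑ k ∈ Icc 1 x, k = x * (x + 1) / 2 := by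
  induction x with
  | zero => simp
  | succ n ih =>
    rw [Finset.sum_Icc_succ_top (by omega), ih]
    have : (n + 1) * (n + 1 + 1) = n * (n + 1) + (n + 1) * 2 := by ring
    rw [this, Nat.add_mul_div_right _ _ (by norm_num)]

/-- `D(x) ≤ 2^{x(x+1)/2}`. [folklore] -/
theorem romanovD_le_two_pow (x : ℕ) : romanovD x ≤ 2 ^ (x * (x + 1) / 2) := by
  rw [romanovD, ← sum_Icc_id_eq, ← Finset.prod_pow_eq_pow_sum]
  exact Finset.prod_le_prod' fun k _ => Nat.sub_le _ _

/-- `D(x)` is odd. [folklore] -/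
theorem odd_romanovD (x : ℕ) : Odd (romanovD x) := by
  rw [romanovD]
  refine Finset.prod_induction _ Odd (fun a b ha hb => ha.mul hb) odd_one fun k hk => ?_
  have hk1 : 1 ≤ k := (Finset.mem_Icc.1 hk).1
  have h2 : 2 ^ k = 2 * 2 ^ (k - 1) := by
    rw [← pow_succ']; congr 1; omega
  have h3 : 1 ≤ 2 ^ (k - 1) := Nat.one_le_two_pow
  exact ⟨2 ^ (k - 1) - 1, by omega⟩

/-- Prime factors of an odd number exceed `2`. [folklore] -/
theorem two_lt_of_mem_primeFactors_odd {n p : ℕ} (hn : Odd n) (hp : p ∈ n.primeFactors) : 2 < p := by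
  have hpP := Nat.prime_of_mem_primeFactors hp
  have hpd := Nat.dvd_of_mem_primeFactors hp
  rcases hpP.eq_two_or_odd' with rfl | hodd
  · exact absurd (even_iff_two_dvd.2 hpd) (Nat.not_even_iff_odd.2 hn)
  · have := hpP.two_le
    rcases this.eq_or_lt with h | h
    · exact absurd h.symm (by rintro rfl; exact (Nat.not_even_iff_odd.2 hodd) even_two)
    · exact h

/-- `1 ≤ ∏ f` for real factors `≥ 1`. [folklore] -/
theorem one_le_prod_real {ι : Type*} (s : Finset ι) {f : ι → ℝ} (h : ∀ i ∈ s, 1 ≤ f i) :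
    1 ≤ ∏ i ∈ s, f i := by
  calc (1 : ℝ) = ∏ _i ∈ s, (1 : ℝ) := by simp
    _ ≤ ∏ i ∈ s, f i := Finset.prod_le_prod (fun _ _ => zero_le_one) h

/-- **`H(n) ≤ C₀⁻¹ ∏_{p ∣ n} p/(p−1)`** for odd `n ≠ 0`: `(p−1)/(p−2) = [p/(p−1)]·[1 − (p−1)⁻²]⁻¹` and
`∏_{p ∣ n}(1 − (p−1)⁻²) ≥ ∏_{2<p≤n}(1 − (p−1)⁻²) ≥ C₀` (`Chen.twinPrimeConst_le_twinPrimeConstPartial`).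
[cite: HeathbrownPuchta2002, §5 (41)] -/
theorem hFactor_le_inv_twinPrimeConst_mul {n : ℕ} (hn : n ≠ 0) (hodd : Odd n) :
    hFactor n ≤ twinPrimeConst⁻¹ * ∏ p ∈ n.primeFactors, (p : ℝ) / ((p : ℝ) - 1) := by
  have hC : (0.65828 : ℝ) ≤ twinPrimeConst := twinPrimeConst_ge
  have hC0 : 0 < twinPrimeConst := by linarith
  have hgt : ∀ p ∈ n.primeFactors, (2 : ℝ) < p := fun p hp => by
    exact_mod_cast two_lt_of_mem_primeFactors_odd hodd hp
  have hfilt : n.primeFactors.filter (2 < ·) = n.primeFactors :=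
    Finset.filter_true_of_mem fun p hp => two_lt_of_mem_primeFactors_odd hodd hp
  have hH : hFactor n = (∏ p ∈ n.primeFactors, (p : ℝ) / ((p : ℝ) - 1)) *
      (∏ p ∈ n.primeFactors, (1 - 1 / ((p : ℝ) - 1) ^ 2))⁻¹ := by
    rw [hFactor, hfilt, ← Finset.prod_inv_distrib, ← Finset.prod_mul_distrib]
    refine Finset.prod_congr rfl fun p hp => ?_
    have h2 := hgt p hp
    have h1 : (p : ℝ) - 1 ≠ 0 := by linarith
    have h3 : (p : ℝ) - 2 ≠ 0 := by linarith
    have h4 : (p : ℝ) ≠ 0 := by linarith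
    have h5 : (1 - 1 / ((p : ℝ) - 1) ^ 2) = (p : ℝ) * ((p : ℝ) - 2) / ((p : ℝ) - 1) ^ 2 := by
      field_simp; ring
    rw [h5]
    field_simp
  -- `C₀ ≤ ∏_{p ∣ n} (1 − (p−1)⁻²)`
  have hsub : n.primeFactors ⊆ (Nat.primesLE n).filter (2 < ·) := by
    intro p hp
    rw [Finset.mem_filter, Nat.mem_primesLE]
    exact ⟨⟨Nat.le_of_dvd (Nat.pos_of_ne_zero hn) (Nat.dvd_of_mem_primeFactors hp),
      Nat.prime_of_mem_primeFactors hp⟩, two_lt_of_mem_primeFactors_odd hodd hp⟩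
  have hfac01 : ∀ p ∈ (Nat.primesLE n).filter (2 < ·),
      0 ≤ (1 - 1 / ((p : ℝ) - 1) ^ 2) ∧ (1 - 1 / ((p : ℝ) - 1) ^ 2) ≤ 1 := by
    intro p hp
    have h2 : (2 : ℝ) < p := by exact_mod_cast (Finset.mem_filter.1 hp).2
    have h3 : (3 : ℝ) ≤ p := by
      have : 3 ≤ p := (Finset.mem_filter.1 hp).2
      exact_mod_cast this
    have h1 : 1 ≤ ((p : ℝ) - 1) ^ 2 := by nlinarith
    constructor
    · rw [sub_nonneg, div_le_one (by positivity)]; exact h1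
    · have : 0 ≤ 1 / ((p : ℝ) - 1) ^ 2 := by positivity
      linarith
  have hprod_ge : twinPrimeConst ≤ ∏ p ∈ n.primeFactors, (1 - 1 / ((p : ℝ) - 1) ^ 2) := by
    calc twinPrimeConst ≤ twinPrimeConstPartial n := Chen.twinPrimeConst_le_twinPrimeConstPartial n
      _ = (∏ p ∈ (Nat.primesLE n).filter (2 < ·) \ n.primeFactors, (1 - 1 / ((p : ℝ) - 1) ^ 2)) *
            ∏ p ∈ n.primeFactors, (1 - 1 / ((p : ℝ) - 1) ^ 2) := by
          rw [twinPrimeConstPartial, Finset.prod_sdiff hsub]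
      _ ≤ 1 * ∏ p ∈ n.primeFactors, (1 - 1 / ((p : ℝ) - 1) ^ 2) := by
          refine mul_le_mul_of_nonneg_right ?_ (Finset.prod_nonneg fun p hp => (hfac01 p (hsub hp)).1)
          exact Finset.prod_le_one (fun p hp => (hfac01 p (Finset.sdiff_subset hp)).1)
            fun p hp => (hfac01 p (Finset.sdiff_subset hp)).2
      _ = _ := one_mul _
  have hP0 : 0 ≤ ∏ p ∈ n.primeFactors, (p : ℝ) / ((p : ℝ) - 1) :=
    Finset.prod_nonneg fun p hp => by
      have := hgt p hp
      have : 0 < (p : ℝ) - 1 := by linarith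
      positivity
  rw [hH, mul_comm]
  exact mul_le_mul_of_nonneg_right ((inv_le_inv₀ (lt_of_lt_of_le hC0 hprod_ge) hC0).2 hprod_ge) hP0

/-- **The primorial bound**: for odd `n ≠ 0` with `n < (y+1)^{r+1}`, `y ≥ 1`:
`∏_{p ∣ n} p/(p−1) ≤ (∏_{p ∣ n, p ≤ y} p/(p−1)) · (1 + 1/y)^r` (at most `r` prime factors exceed `y`).
[cite: HeathbrownPuchta2002, §5 (41)] -/
theorem prod_primeFactors_div_pred_le {n y r : ℕ} (hn : n ≠ 0) (hy : 1 ≤ y)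
    (hlt : n < (y + 1) ^ (r + 1)) :
    ∏ p ∈ n.primeFactors, (p : ℝ) / ((p : ℝ) - 1) ≤
      (∏ p ∈ n.primeFactors with p ≤ y, (p : ℝ) / ((p : ℝ) - 1)) * ((y + 1 : ℝ) / y) ^ r := by
  have hy0 : (0 : ℝ) < y := by exact_mod_cast hy
  rw [← Finset.prod_filter_mul_prod_filter_not n.primeFactors (fun p => p ≤ y)]
  have hbig : ∀ p ∈ n.primeFactors.filter (fun p => ¬ p ≤ y), y + 1 ≤ p := fun p hp => by
    have := (Finset.mem_filter.1 hp).2; omega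
  -- at most `r` large prime factors
  have hcard : (n.primeFactors.filter (fun p => ¬ p ≤ y)).card ≤ r := by
    have h1 : (y + 1) ^ (n.primeFactors.filter (fun p => ¬ p ≤ y)).card ≤ n := by
      calc (y + 1) ^ (n.primeFactors.filter (fun p => ¬ p ≤ y)).card
          ≤ ∏ p ∈ n.primeFactors.filter (fun p => ¬ p ≤ y), p := Finset.pow_card_le_prod _ _ _ hbig
        _ ≤ ∏ p ∈ n.primeFactors, p :=
            Finset.prod_le_prod_of_subset_of_one_le' (Finset.filter_subset _ _)
              fun p hp _ => (Nat.prime_of_mem_primeFactors hp).one_lt.le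
        _ ≤ n := Nat.le_of_dvd (Nat.pos_of_ne_zero hn) (Nat.prod_primeFactors_dvd n)
    have h2 := (Nat.pow_lt_pow_iff_right (by omega : 1 < y + 1)).1 (lt_of_le_of_lt h1 hlt)
    omega
  have hle : ∏ p ∈ n.primeFactors.filter (fun p => ¬ p ≤ y), (p : ℝ) / ((p : ℝ) - 1) ≤
      ((y + 1 : ℝ) / y) ^ (n.primeFactors.filter (fun p => ¬ p ≤ y)).card := by
    rw [← Finset.prod_const]
    refine Finset.prod_le_prod (fun p hp => ?_) fun p hp => ?_
    · have : (y : ℝ) + 1 ≤ p := by exact_mod_cast hbig p hp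
      have : 0 < (p : ℝ) - 1 := by linarith
      positivity
    · have hp1 : (y : ℝ) + 1 ≤ p := by exact_mod_cast hbig p hp
      have hp0 : 0 < (p : ℝ) - 1 := by linarith
      rw [div_le_div_iff₀ hp0 hy0]
      nlinarith
  have hge1 : (1 : ℝ) ≤ (y + 1 : ℝ) / y := by
    rw [le_div_iff₀ hy0]; linarith
  have hP0 : 0 ≤ ∏ p ∈ n.primeFactors with p ≤ y, (p : ℝ) / ((p : ℝ) - 1) :=
    Finset.prod_nonneg fun p hp => by
      have h2 : 2 ≤ p := (Nat.prime_of_mem_primeFactors (Finset.mem_filter.1 hp).1).two_le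
      have : (2 : ℝ) ≤ p := by exact_mod_cast h2
      have : 0 < (p : ℝ) - 1 := by linarith
      positivity
  exact mul_le_mul_of_nonneg_left (hle.trans (pow_le_pow_right₀ hge1 hcard)) hP0

/-- **Tail majorant, abstract form**: for `y ≥ 1` and `D(x) < (y+1)^{r+1}`,
`E(x) ≤ C₀⁻¹ · (∏_{p ∣ D(x), p ≤ y} p/(p−1)) · (1 + 1/y)^r`. [cite: HeathbrownPuchta2002, §5 (41)] -/
theorem sum_filter_ordTwo_le_tail (s : Finset ℕ) (x : ℕ) {y r : ℕ} (hy : 1 ≤ y)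
    (hlt : romanovD x < (y + 1) ^ (r + 1)) :
    ∑ t ∈ s with ordTwo t ≤ x, fq 1 t ≤ twinPrimeConst⁻¹ *
      ((∏ p ∈ (romanovD x).primeFactors with p ≤ y, (p : ℝ) / ((p : ℝ) - 1)) * ((y + 1 : ℝ) / y) ^ r) := by
  have hC : (0.65828 : ℝ) ≤ twinPrimeConst := twinPrimeConst_ge
  have hC0 : 0 ≤ twinPrimeConst⁻¹ := by positivity
  calc ∑ t ∈ s with ordTwo t ≤ x, fq 1 t ≤ hFactor (romanovD x) := sum_filter_ordTwo_le_hFactor s x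
    _ ≤ twinPrimeConst⁻¹ * ∏ p ∈ (romanovD x).primeFactors, (p : ℝ) / ((p : ℝ) - 1) :=
        hFactor_le_inv_twinPrimeConst_mul (romanovD_ne_zero x) (odd_romanovD x)
    _ ≤ _ := mul_le_mul_of_nonneg_left
        (prod_primeFactors_div_pred_le (romanovD_ne_zero x) hy hlt) hC0

/-- `D(x) < 2^{K(r+1)}` with `r = ⌊x(x+1)/2 / K⌋`, `K ≥ 1`. [folklore] -/
theorem romanovD_lt_two_pow_mul (x : ℕ) {K : ℕ} (hK : 1 ≤ K) :
    romanovD x < (2 ^ K - 1 + 1) ^ (x * (x + 1) / 2 / K + 1) := by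
  have h2K : 2 ^ K - 1 + 1 = 2 ^ K := Nat.sub_add_cancel Nat.one_le_two_pow
  rw [h2K, ← pow_mul]
  refine lt_of_le_of_lt (romanovD_le_two_pow x) (Nat.pow_lt_pow_right (by norm_num) ?_)
  set T := x * (x + 1) / 2
  have h1 : T % K < K := Nat.mod_lt _ (by omega)
  have h2 : K * (T / K) + T % K = T := Nat.div_add_mod T K
  rw [Nat.mul_add, mul_one]
  omega


/-! ### §5 Kernel-evaluable prime products `∏_{3 ≤ p ≤ 2N+1} p/(p−1)` -/

/-- The primes below `182`. [folklore] -/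
def tdList : List ℕ :=
  [2, 3, 5, 7, 11, 13, 17, 19, 23, 29, 31, 37, 41, 43, 47, 53, 59, 61, 67, 71, 73, 79, 83, 89, 97, 101, 103, 107,
    109, 113, 127, 131, 137, 139, 149, 151, 157, 163, 167, 173, 179, 181]

/-- Every entry of `tdList` is `≥ 2`. [folklore] -/
theorem two_le_of_mem_tdList : ∀ d ∈ tdList, 2 ≤ d := by decide

/-- Trial division by the primes below `182`: a test passed by EVERY prime (and, below `191² > 2^15`, only by
primes — but only the superset direction is used). [folklore] -/
def tdPrime (m : ℕ) : Bool :=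
  decide (2 ≤ m) && tdList.all fun d => decide (m ≤ d) || !decide (m % d = 0)

/-- Every prime passes `tdPrime`. [folklore] -/
theorem tdPrime_of_prime {m : ℕ} (hm : m.Prime) : tdPrime m = true := by
  simp only [tdPrime, Bool.and_eq_true, decide_eq_true_eq, List.all_eq_true, Bool.or_eq_true,
    Bool.not_eq_true', decide_eq_false_iff_not]
  refine ⟨hm.two_le, fun d hd => ?_⟩
  by_cases hmd : m ≤ d
  · exact Or.inl hmd
  refine Or.inr fun h0 => ?_
  have hdvd : d ∣ m := Nat.dvd_of_mod_eq_zero h0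
  have h2 := two_le_of_mem_tdList d hd
  rcases (Nat.dvd_prime hm).1 hdvd with rfl | rfl <;> omega

/-- `g(m) = m/(m−1)` if `m` passes `tdPrime`, else `1` (in `ℚ`). [folklore] -/
def gQ (m : ℕ) : ℚ := if tdPrime m = true then (m : ℚ) / ((m : ℚ) - 1) else 1

/-- `g(m) ≥ 1`. [folklore] -/
theorem one_le_gQ (m : ℕ) : (1 : ℝ) ≤ ((gQ m : ℚ) : ℝ) := by
  unfold gQ
  split_ifs with h
  · have h2 : 2 ≤ m := by
      simp only [tdPrime, Bool.and_eq_true, decide_eq_true_eq] at h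
      exact h.1
    have h2' : (2 : ℝ) ≤ m := by exact_mod_cast h2
    push_cast
    rw [le_div_iff₀ (by linarith)]
    linarith
  · simp

/-- `g(p) = p/(p−1)` for prime `p`. [folklore] -/
theorem gQ_of_prime {m : ℕ} (hm : m.Prime) : ((gQ m : ℚ) : ℝ) = (m : ℝ) / ((m : ℝ) - 1) := by
  rw [gQ, if_pos (tdPrime_of_prime hm)]
  push_cast
  ring

/-- The chunk product `∏_{i<n} g(a + 2i)` as a list product (kernel-evaluable). [folklore] -/
def ppQ (a n : ℕ) : ℚ := ((List.range n).map fun i => gQ (a + 2 * i)).prod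

/-- List products over `List.range` are `Finset.range` products. [folklore] -/
theorem list_prod_range_map (f : ℕ → ℚ) (n : ℕ) :
    ((List.range n).map f).prod = ∏ i ∈ Finset.range n, f i := by
  induction n with
  | zero => simp
  | succ n ih => rw [List.range_succ, List.map_append, List.prod_append, ih, Finset.prod_range_succ]; simp

/-- `ppQ` as a `Finset` product. [folklore] -/
theorem ppQ_eq (a n : ℕ) : ppQ a n = ∏ i ∈ Finset.range n, gQ (a + 2 * i) := list_prod_range_map _ n

/-- `PP N = ∏_{i<N} g(3+2i) ≥ ∏_{3 ≤ p ≤ 2N+1, p prime} p/(p−1)` (real). [folklore] -/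
noncomputable def PP (N : ℕ) : ℝ := ((∏ i ∈ Finset.range N, gQ (3 + 2 * i) : ℚ) : ℝ)

/-- `PP N = ppQ 3 N`. [folklore] -/
theorem PP_eq_ppQ (N : ℕ) : PP N = ((ppQ 3 N : ℚ) : ℝ) := by rw [PP, ppQ_eq]

/-- Chunking: `PP (N₁ + N₂) = PP N₁ · ppQ (3 + 2N₁) N₂`. [folklore] -/
theorem PP_add (N₁ N₂ : ℕ) : PP (N₁ + N₂) = PP N₁ * ((ppQ (3 + 2 * N₁) N₂ : ℚ) : ℝ) := by
  rw [PP, PP, ppQ_eq, Finset.prod_range_add]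
  push_cast
  congr 1
  refine Finset.prod_congr rfl fun i _ => ?_
  rw [show 3 + 2 * (N₁ + i) = 3 + 2 * N₁ + 2 * i by ring]

/-- `PP N ≥ 0`. [folklore] -/
theorem PP_nonneg (N : ℕ) : 0 ≤ PP N := by
  rw [PP]; push_cast
  exact Finset.prod_nonneg fun i _ => zero_le_one.trans (one_le_gQ _)

/-- **Odd primes `≤ 2N+1` against the kernel product**: for a set `P` of odd primes `≤ 2N+1`,
`∏_{p ∈ P} p/(p−1) ≤ PP N`. [folklore] -/
theorem prod_div_pred_le_PP (P : Finset ℕ) (N : ℕ) (hP : ∀ p ∈ P, p.Prime ∧ 2 < p ∧ p ≤ 2 * N + 1) :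
    ∏ p ∈ P, (p : ℝ) / ((p : ℝ) - 1) ≤ PP N := by
  classical
  set O : Finset ℕ := (Finset.range N).image (fun i => 3 + 2 * i) with hO
  have hPO : P ⊆ O := by
    intro p hp
    obtain ⟨hpP, hp2, hpN⟩ := hP p hp
    have hodd : Odd p := hpP.odd_of_ne_two (by omega)
    obtain ⟨k, hk⟩ := hodd
    rw [hO, Finset.mem_image]
    exact ⟨k - 1, Finset.mem_range.2 (by omega), by omega⟩
  have hPeq : ∏ p ∈ P, (p : ℝ) / ((p : ℝ) - 1) = ∏ p ∈ P, ((gQ p : ℚ) : ℝ) :=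
    Finset.prod_congr rfl fun p hp => (gQ_of_prime (hP p hp).1).symm
  have hOeq : ∏ m ∈ O, ((gQ m : ℚ) : ℝ) = PP N := by
    rw [PP, Rat.cast_prod, hO, Finset.prod_image (fun i _ j _ h => by omega)]
  rw [hPeq, ← hOeq, ← Finset.prod_sdiff hPO]
  exact le_mul_of_one_le_left (Finset.prod_nonneg fun p _ => zero_le_one.trans (one_le_gQ p))
    (one_le_prod_real _ fun m _ => one_le_gQ m)

/-! ### §6 The far range: primes between `2^15` and `2^K` via the Mertens window bound -/

/-- `e^{10} ≤ 2^{15}`. [folklore] -/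
theorem exp_ten_le_two_pow : Real.exp 10 ≤ (2 : ℝ) ^ 15 := by
  have h := Real.exp_one_lt_d9
  have h0 : 0 ≤ Real.exp 1 := (Real.exp_pos 1).le
  have h1 : Real.exp 1 ^ 10 = Real.exp 10 := by rw [← Real.exp_nat_mul]; norm_num
  rw [← h1]
  calc Real.exp 1 ^ 10 ≤ (2.7182818286 : ℝ) ^ 10 := pow_le_pow_left₀ h0 h.le 10
    _ ≤ (2 : ℝ) ^ 15 := by norm_num

/-- Telescoping: `∑_{a < m ≤ b} (1/(m−1) − 1/m) = 1/a − 1/b` (`1 ≤ a ≤ b`). [folklore] -/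
theorem sum_Ioc_inv_pred_sub_inv {a : ℕ} (ha : 1 ≤ a) :
    ∀ b, a ≤ b → ∑ m ∈ Ioc a b, (1 / ((m : ℝ) - 1) - 1 / (m : ℝ)) = 1 / (a : ℝ) - 1 / (b : ℝ) := by
  refine Nat.le_induction (by simp) fun b hab ih => ?_
  rw [Finset.sum_Ioc_succ_top hab, ih]
  have hb : (1 : ℝ) ≤ b := by exact_mod_cast (ha.trans hab)
  have ha' : (1 : ℝ) ≤ a := by exact_mod_cast ha
  have e1 : ((b + 1 : ℕ) : ℝ) - 1 = b := by push_cast; ring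
  rw [e1]
  have hb0 : (b : ℝ) ≠ 0 := by positivity
  have hb1 : ((b + 1 : ℕ) : ℝ) ≠ 0 := by positivity
  have ha0 : (a : ℝ) ≠ 0 := by positivity
  field_simp
  push_cast
  ring

/-- `p/(p−1) ≤ exp(1/(p−1))` for `p ≥ 2` (from `1 − 1/p ≥ e^{−1/(p−1)}`). [folklore] -/
theorem div_pred_le_exp {p : ℕ} (hp : 2 ≤ p) :
    (p : ℝ) / ((p : ℝ) - 1) ≤ Real.exp (1 / ((p : ℝ) - 1)) := by
  have hp2 : (2 : ℝ) ≤ p := by exact_mod_cast hp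
  have h := Literature.NumberTheory.LFunctions.MertensBound.exp_neg_inv_pred_le p hp
  have hpos : 0 < Real.exp (-(1 / ((p : ℝ) - 1))) := Real.exp_pos _
  have hp0 : (p : ℝ) ≠ 0 := by positivity
  have e1 : (1 : ℝ) - 1 / (p : ℝ) = ((p : ℝ) - 1) / p := by field_simp
  calc (p : ℝ) / ((p : ℝ) - 1) = (1 - 1 / (p : ℝ))⁻¹ := by rw [e1, inv_div]
    _ ≤ (Real.exp (-(1 / ((p : ℝ) - 1))))⁻¹ := inv_anti₀ hpos h
    _ = Real.exp (1 / ((p : ℝ) - 1)) := by rw [Real.exp_neg, inv_inv]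

/-- **The large primes** (`K ≥ 16`): for odd `n`,
`∏_{p ∣ n, 2^15 ≤ p ≤ 2^K − 1} p/(p−1) ≤ exp(1.0722 · log(K/15) + 0.07912)`, by `p/(p−1) ≤ e^{1/(p−1)}`,
`∑ 1/(p(p−1)) ≤ 2^{−15}`, the window bound `∑_{2^15 < p ≤ 2^K} 1/p ≤ 1.0722 log(K/15) + 0.133/log 2^15 + 12/2^{7.5}`
(`MertensChebyshev.sum_inv_primes_window_le`), and `log 2 ≥ 0.6931471803`. [cite: Ford2002, §2] -/
theorem prod_large_primes_le {n K : ℕ} (hK : 16 ≤ K) (hodd : Odd n) :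
    ∏ p ∈ (n.primeFactors.filter (fun p => p ≤ 2 ^ K - 1)).filter (fun p => ¬ p ≤ 2 ^ 15 - 1),
        (p : ℝ) / ((p : ℝ) - 1)
      ≤ Real.exp (Real.log ((K : ℝ) / 15) * 1.0722 + 0.07912) := by
  set P := (n.primeFactors.filter (fun p => p ≤ 2 ^ K - 1)).filter (fun p => ¬ p ≤ 2 ^ 15 - 1) with hPdef
  have h15K : 2 ^ 15 ≤ 2 ^ K := Nat.pow_le_pow_right (by norm_num) (by omega)
  have hmem : ∀ p ∈ P, p.Prime ∧ 2 ^ 15 < p ∧ p ≤ 2 ^ K := by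
    intro p hp
    simp only [hPdef, Finset.mem_filter] at hp
    obtain ⟨⟨hpf, hle⟩, hgt⟩ := hp
    have hpP := Nat.prime_of_mem_primeFactors hpf
    have h2 := two_lt_of_mem_primeFactors_odd hodd hpf
    refine ⟨hpP, ?_, by omega⟩
    rcases (show 2 ^ 15 ≤ p by omega).eq_or_lt with h | h
    · exfalso
      have h2p : 2 ∣ p := by rw [← h]; norm_num
      rcases (Nat.dvd_prime hpP).1 h2p with h' | h' <;> omega
    · exact h
  -- step 1: `∏ ≤ exp (∑ 1/(p−1))`
  have h1 : ∏ p ∈ P, (p : ℝ) / ((p : ℝ) - 1) ≤ Real.exp (∑ p ∈ P, 1 / ((p : ℝ) - 1)) := by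
    rw [Real.exp_sum]
    refine Finset.prod_le_prod (fun p hp => ?_) fun p hp => div_pred_le_exp (hmem p hp).1.two_le
    have : (2 : ℝ) ≤ p := by exact_mod_cast (hmem p hp).1.two_le
    have : 0 < (p : ℝ) - 1 := by linarith
    positivity
  -- step 2: `∑ 1/(p−1) ≤ ∑ 1/p + 2^{−15}`
  have h2 : ∑ p ∈ P, 1 / ((p : ℝ) - 1) ≤ ∑ p ∈ P, 1 / (p : ℝ) + 1 / 2 ^ 15 := by
    have hsplit : ∀ p ∈ P, 1 / ((p : ℝ) - 1) = 1 / (p : ℝ) + (1 / ((p : ℝ) - 1) - 1 / (p : ℝ)) := by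
      intro p _; ring
    rw [Finset.sum_congr rfl hsplit, Finset.sum_add_distrib]
    refine add_le_add (le_refl _) ?_
    have hsub : P ⊆ Ioc (2 ^ 15) (2 ^ K) := fun p hp =>
      Finset.mem_Ioc.2 ⟨(hmem p hp).2.1, (hmem p hp).2.2⟩
    calc ∑ p ∈ P, (1 / ((p : ℝ) - 1) - 1 / (p : ℝ))
        ≤ ∑ m ∈ Finset.Ioc (2 ^ 15 : ℕ) (2 ^ K), (1 / ((m : ℝ) - 1) - 1 / (m : ℝ)) := by
          refine Finset.sum_le_sum_of_subset_of_nonneg hsub fun m hm _ => ?_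
          have hm1 : 2 ^ 15 < m := (Finset.mem_Ioc.1 hm).1
          have hm2 : (2 : ℝ) ≤ m := by exact_mod_cast (show 2 ≤ m by omega)
          have : 0 < (m : ℝ) - 1 := by linarith
          rw [sub_nonneg]
          exact one_div_le_one_div_of_le this (by linarith)
      _ = 1 / ((2 ^ 15 : ℕ) : ℝ) - 1 / ((2 ^ K : ℕ) : ℝ) :=
          sum_Ioc_inv_pred_sub_inv (a := 2 ^ 15) Nat.one_le_two_pow (2 ^ K) h15K
      _ ≤ 1 / ((2 ^ 15 : ℕ) : ℝ) := by
          have : 0 ≤ 1 / ((2 ^ K : ℕ) : ℝ) := by positivity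
          linarith
      _ = 1 / 2 ^ 15 := by norm_num
  -- step 3: the window bound
  have h3 : ∑ p ∈ P, 1 / (p : ℝ) ≤ 1.0722 * (Real.log (Real.log ((2 : ℝ) ^ K)) - Real.log (Real.log ((2 : ℝ) ^ 15)))
      + 0.133 / Real.log ((2 : ℝ) ^ 15) + 12 / Real.sqrt ((2 : ℝ) ^ 15) := by
    have hyx : (2 : ℝ) ^ 15 ≤ (2 : ℝ) ^ K := pow_le_pow_right₀ (by norm_num) (by omega)
    have hw := Literature.NumberTheory.LFunctions.MertensChebyshev.sum_inv_primes_window_le exp_ten_le_two_pow hyx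
    have hfl15 : ⌊(2 : ℝ) ^ 15⌋₊ = 2 ^ 15 := by
      rw [show (2 : ℝ) ^ 15 = ((2 ^ 15 : ℕ) : ℝ) by norm_num, Nat.floor_natCast]
    have hflK : ⌊(2 : ℝ) ^ K⌋₊ = 2 ^ K := by
      rw [show (2 : ℝ) ^ K = ((2 ^ K : ℕ) : ℝ) by norm_num, Nat.floor_natCast]
    rw [hfl15, hflK] at hw
    refine le_trans (Finset.sum_le_sum_of_subset_of_nonneg (fun p hp => ?_) fun p _ _ => by positivity) hw
    exact Finset.mem_filter.2 ⟨Finset.mem_Ioc.2 ⟨(hmem p hp).2.1, (hmem p hp).2.2⟩, (hmem p hp).1⟩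
  -- step 4: numerics
  have hlog2 := Real.log_two_gt_d9
  have hl2pos : 0 < Real.log 2 := by linarith
  have hK0 : (0 : ℝ) < K := by exact_mod_cast (show 0 < K by omega)
  have hlogK : Real.log (Real.log ((2 : ℝ) ^ K)) - Real.log (Real.log ((2 : ℝ) ^ 15)) =
      Real.log ((K : ℝ) / 15) := by
    have e1 : Real.log ((2 : ℝ) ^ K) = (K : ℝ) * Real.log 2 := by rw [Real.log_pow]
    have e2 : Real.log ((2 : ℝ) ^ 15) = (15 : ℝ) * Real.log 2 := by rw [Real.log_pow]; norm_num
    rw [e1, e2, Real.log_mul hK0.ne' hl2pos.ne', Real.log_mul (by norm_num) hl2pos.ne',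
      Real.log_div hK0.ne' (by norm_num)]
    ring
  have hl15 : (10.3972077 : ℝ) ≤ Real.log ((2 : ℝ) ^ 15) := by
    rw [Real.log_pow]; push_cast; nlinarith
  have hsq : (181.019 : ℝ) ≤ Real.sqrt ((2 : ℝ) ^ 15) := (Real.le_sqrt' (by norm_num)).2 (by norm_num)
  have hc1 : 0.133 / Real.log ((2 : ℝ) ^ 15) ≤ 0.133 / 10.3972077 :=
    div_le_div_of_nonneg_left (by norm_num) (by norm_num) hl15
  have hc2 : 12 / Real.sqrt ((2 : ℝ) ^ 15) ≤ 12 / 181.019 :=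
    div_le_div_of_nonneg_left (by norm_num) (by norm_num) hsq
  have hsum : ∑ p ∈ P, 1 / ((p : ℝ) - 1) ≤ Real.log ((K : ℝ) / 15) * 1.0722 + 0.07912 := by
    have := h2.trans (add_le_add h3 (le_refl ((1:ℝ) / 2 ^ 15)))
    rw [hlogK] at this
    have hnum : (0.133 : ℝ) / 10.3972077 + 12 / 181.019 + 1 / 2 ^ 15 ≤ 0.07912 := by norm_num
    linarith
  exact h1.trans (Real.exp_le_exp.2 hsum)

/-- Bernoulli: `exp(1.0722 · log u) = u^{1.0722} ≤ u · (1 + 0.0722 (u − 1))` for `u ≥ 1`. [folklore] -/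
theorem exp_log_mul_le {u : ℝ} (hu : 1 ≤ u) :
    Real.exp (Real.log u * 1.0722) ≤ u * (1 + 0.0722 * (u - 1)) := by
  have hu0 : 0 < u := by linarith
  rw [← Real.rpow_def_of_pos hu0, show (1.0722 : ℝ) = 1 + 0.0722 by norm_num, Real.rpow_add hu0,
    Real.rpow_one]
  refine mul_le_mul_of_nonneg_left ?_ hu0.le
  have h := rpow_one_add_le_one_add_mul_self (s := u - 1) (by linarith) (p := 0.0722) (by norm_num)
    (by norm_num)
  rw [show (1 : ℝ) + (u - 1) = u by ring] at h
  exact h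

/-- The power factor: `(1 + 1/y)^r ≤ e^{r/y} ≤ e^{1/K} ≤ K/(K−1)` when `rK ≤ y`, `K ≥ 2`. [folklore] -/
theorem pow_factor_le {y r K : ℕ} (hy1 : 1 ≤ y) (hK : 2 ≤ K) (hr : r * K ≤ y) :
    (((y : ℝ) + 1) / y) ^ r ≤ (K : ℝ) / ((K : ℝ) - 1) := by
  have hy : (1 : ℝ) ≤ y := by exact_mod_cast hy1
  have hK1 : (2 : ℝ) ≤ K := by exact_mod_cast hK
  have hy0 : (y : ℝ) ≠ 0 := by positivity
  have h1 : ((y : ℝ) + 1) / y = 1 + 1 / y := by field_simp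
  have h2 : (1 : ℝ) + 1 / y ≤ Real.exp (1 / y) := by
    have := Real.add_one_le_exp (1 / (y : ℝ)); linarith
  have h3 : (((y : ℝ) + 1) / y) ^ r ≤ Real.exp ((r : ℝ) * (1 / y)) := by
    rw [h1, Real.exp_nat_mul]
    exact pow_le_pow_left₀ (by positivity) h2 r
  have h4 : (r : ℝ) * (1 / y) ≤ 1 / K := by
    have hrK : (r : ℝ) * K ≤ y := by exact_mod_cast hr
    rw [mul_one_div, div_le_div_iff₀ (by positivity) (by positivity), one_mul]
    exact hrK
  have h5 : Real.exp (1 / (K : ℝ)) ≤ (K : ℝ) / ((K : ℝ) - 1) := by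
    have hlt : 1 / (K : ℝ) < 1 := by rw [div_lt_one (by positivity)]; linarith
    refine (Real.exp_bound_div_one_sub_of_interval (by positivity) hlt).trans (le_of_eq ?_)
    rw [one_sub_div (by positivity : (K : ℝ) ≠ 0), one_div_div]
  exact h3.trans ((Real.exp_le_exp.2 h4).trans h5)

/-- `r K ≤ 2^K − 1` for `r = ⌊x(x+1)/2 / K⌋`, `K = 2j+1`, `x + 1 ≤ 2^{j+1}`. [folklore] -/
theorem div_mul_le_two_pow_sub_one {x j : ℕ} (hx : x + 1 ≤ 2 ^ (j + 1)) :
    x * (x + 1) / 2 / (2 * j + 1) * (2 * j + 1) ≤ 2 ^ (2 * j + 1) - 1 := by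
  have ha : 2 ^ (j + 1) = 2 * 2 ^ j := by rw [pow_succ]; ring
  have hb : 2 ^ (2 * j + 1) = 2 * 2 ^ j * 2 ^ j := by rw [pow_succ, two_mul, pow_add]; ring
  have hj1 : 1 ≤ 2 ^ j := Nat.one_le_two_pow
  rw [hb]
  rw [ha] at hx
  set a := 2 ^ j with ha'
  have h1 : x * (x + 1) ≤ (2 * a - 1) * (2 * a) := Nat.mul_le_mul (by omega) (by omega)
  have h2 : x * (x + 1) / 2 ≤ (2 * a - 1) * a := by
    calc x * (x + 1) / 2 ≤ (2 * a - 1) * (2 * a) / 2 := Nat.div_le_div_right h1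
      _ = (2 * a - 1) * a := by
          rw [show (2 * a - 1) * (2 * a) = (2 * a - 1) * a * 2 by ring, Nat.mul_div_cancel _ two_pos]
  have h3 : (2 * a - 1) * a = 2 * a * a - a := by
    rw [Nat.sub_one_mul]
  calc x * (x + 1) / 2 / (2 * j + 1) * (2 * j + 1) ≤ x * (x + 1) / 2 := Nat.div_mul_le_self _ _
    _ ≤ 2 * a * a - a := h3 ▸ h2
    _ ≤ 2 * a * a - 1 := by omega

/-- The far-range majorant value on the dyadic block `[2^j, 2^{j+1})`, `K = 2j+1`:
`V(j) = C₀⁻¹ · PP(2^14−1) · (1/(1−0.07912)) · (K/15)(1 + 0.0722 (K/15 − 1)) · K/(K−1)`. [folklore] -/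
noncomputable def farV (j : ℕ) : ℝ :=
  twinPrimeConst⁻¹ * (PP (2 ^ 14 - 1) * ((1 / (1 - 0.07912)) *
    ((((2 * j + 1 : ℕ) : ℝ) / 15) * (1 + 0.0722 * ((((2 * j + 1 : ℕ) : ℝ) / 15) - 1)))) *
    ((((2 * j + 1 : ℕ) : ℝ)) / ((((2 * j + 1 : ℕ) : ℝ)) - 1)))

/-- **The far-range majorant**: for `j ≥ 8` and `x + 1 ≤ 2^{j+1}`, `E(x) ≤ V(j)`.
[cite: HeathbrownPuchta2002, §5 (41); Ford2002, §2] -/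
theorem sum_filter_ordTwo_le_farV (s : Finset ℕ) {x j : ℕ} (hj : 8 ≤ j) (hx : x + 1 ≤ 2 ^ (j + 1)) :
    ∑ t ∈ s with ordTwo t ≤ x, fq 1 t ≤ farV j := by
  set K := 2 * j + 1 with hKdef
  have hK16 : 16 ≤ K := by omega
  set y := 2 ^ K - 1 with hydef
  have h2K : 2 ^ 16 ≤ 2 ^ K := Nat.pow_le_pow_right (by norm_num) hK16
  have hy1 : 1 ≤ y := by omega
  set r := x * (x + 1) / 2 / K with hrdef
  have hC : (0.65828 : ℝ) ≤ twinPrimeConst := twinPrimeConst_ge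
  have hC0 : 0 ≤ twinPrimeConst⁻¹ := inv_nonneg.2 (by linarith)
  -- the abstract tail bound
  have hlt : romanovD x < (y + 1) ^ (r + 1) := romanovD_lt_two_pow_mul x (by omega)
  have h0 := sum_filter_ordTwo_le_tail s x hy1 hlt
  -- split the primes `≤ y` at `2^15 − 1`
  have hsplit : ∏ p ∈ (romanovD x).primeFactors with p ≤ y, (p : ℝ) / ((p : ℝ) - 1) =
      (∏ p ∈ ((romanovD x).primeFactors.filter (fun p => p ≤ y)).filter (fun p => p ≤ 2 ^ 15 - 1),
          (p : ℝ) / ((p : ℝ) - 1)) *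
        ∏ p ∈ ((romanovD x).primeFactors.filter (fun p => p ≤ y)).filter (fun p => ¬ p ≤ 2 ^ 15 - 1),
          (p : ℝ) / ((p : ℝ) - 1) :=
    (Finset.prod_filter_mul_prod_filter_not _ _ _).symm
  have hsmall : ∏ p ∈ ((romanovD x).primeFactors.filter (fun p => p ≤ y)).filter (fun p => p ≤ 2 ^ 15 - 1),
      (p : ℝ) / ((p : ℝ) - 1) ≤ PP (2 ^ 14 - 1) := by
    refine prod_div_pred_le_PP _ _ fun p hp => ?_
    simp only [Finset.mem_filter] at hp
    exact ⟨Nat.prime_of_mem_primeFactors hp.1.1, two_lt_of_mem_primeFactors_odd (odd_romanovD x) hp.1.1,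
      by norm_num; omega⟩
  have hlarge := prod_large_primes_le (n := romanovD x) hK16 (odd_romanovD x)
  have hKr : (1 : ℝ) ≤ (K : ℝ) / 15 := by
    rw [le_div_iff₀ (by norm_num)]; exact_mod_cast (show 15 ≤ K by omega)
  have hexp : Real.exp (Real.log ((K : ℝ) / 15) * 1.0722 + 0.07912) ≤
      (1 / (1 - 0.07912)) * (((K : ℝ) / 15) * (1 + 0.0722 * ((K : ℝ) / 15 - 1))) := by
    rw [Real.exp_add, mul_comm]
    exact mul_le_mul (Real.exp_bound_div_one_sub_of_interval (by norm_num) (by norm_num)) (exp_log_mul_le hKr)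
      (Real.exp_pos _).le
      (by norm_num)
  have hpow : (((y : ℝ) + 1) / y) ^ r ≤ (K : ℝ) / ((K : ℝ) - 1) :=
    pow_factor_le hy1 (by omega) (by simpa [hrdef, hKdef, hydef] using div_mul_le_two_pow_sub_one hx)
  -- nonnegativity
  have hA0 : 0 ≤ ∏ p ∈ ((romanovD x).primeFactors.filter (fun p => p ≤ y)).filter (fun p => p ≤ 2 ^ 15 - 1),
      (p : ℝ) / ((p : ℝ) - 1) :=
    Finset.prod_nonneg fun p hp => by
      have h2 : 2 < p := two_lt_of_mem_primeFactors_odd (odd_romanovD x) (Finset.mem_filter.1 (Finset.mem_filter.1 hp).1).1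
      have h2' : (2 : ℝ) < p := by exact_mod_cast h2
      exact (div_pos (by linarith) (by linarith)).le
  have hB0 : 0 ≤ ∏ p ∈ ((romanovD x).primeFactors.filter (fun p => p ≤ y)).filter (fun p => ¬ p ≤ 2 ^ 15 - 1),
      (p : ℝ) / ((p : ℝ) - 1) :=
    Finset.prod_nonneg fun p hp => by
      have h2 : 2 < p := two_lt_of_mem_primeFactors_odd (odd_romanovD x) (Finset.mem_filter.1 (Finset.mem_filter.1 hp).1).1
      have h2' : (2 : ℝ) < p := by exact_mod_cast h2
      exact (div_pos (by linarith) (by linarith)).le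
  have hpow0 : 0 ≤ (((y : ℝ) + 1) / y) ^ r :=
    pow_nonneg (div_nonneg (by exact_mod_cast Nat.zero_le (y + 1)) (Nat.cast_nonneg _)) r
  have hmid : (∏ p ∈ (romanovD x).primeFactors with p ≤ y, (p : ℝ) / ((p : ℝ) - 1)) * (((y : ℝ) + 1) / y) ^ r ≤
      (PP (2 ^ 14 - 1) * ((1 / (1 - 0.07912)) * (((K : ℝ) / 15) * (1 + 0.0722 * ((K : ℝ) / 15 - 1))))) *
        ((K : ℝ) / ((K : ℝ) - 1)) := by
    rw [hsplit]
    refine mul_le_mul (mul_le_mul hsmall (hlarge.trans hexp) hB0 (PP_nonneg _)) hpow hpow0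
      (mul_nonneg (PP_nonneg _) ?_)
    have : 0 ≤ ((K : ℝ) / 15) * (1 + 0.0722 * ((K : ℝ) / 15 - 1)) :=
      mul_nonneg (by linarith) (by linarith)
    exact mul_nonneg (by norm_num) this
  have hcast : ((y : ℕ) : ℝ) + 1 = ((y + 1 : ℕ) : ℝ) := by push_cast; ring
  calc ∑ t ∈ s with ordTwo t ≤ x, fq 1 t
      ≤ twinPrimeConst⁻¹ * ((∏ p ∈ (romanovD x).primeFactors with p ≤ y, (p : ℝ) / ((p : ℝ) - 1)) *
          (((y + 1 : ℕ) : ℝ) / y) ^ r) := by simpa using h0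
    _ = twinPrimeConst⁻¹ * ((∏ p ∈ (romanovD x).primeFactors with p ≤ y, (p : ℝ) / ((p : ℝ) - 1)) *
          (((y : ℝ) + 1) / y) ^ r) := by rw [hcast]
    _ ≤ _ := mul_le_mul_of_nonneg_left hmid hC0
    _ = farV j := by simp only [farV, hKdef]


/-! ### §7 The certificate data (generated by `gen.py`/`emit.py`; every use below is re-verified by the kernel) -/

/-- The certified primes `(p, ord_p 2, b)` with `b² > p` (trial-division bound), `p ∣ 2^e − 1` for some `e ≤ 60`,
sorted by decreasing order; the prime factors of `∏_{e ≤ 60} (2^e − 1)` below `16384²` except those inside the two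
rough cofactors of `roughList`. [cite: HeathbrownPuchta2002, §5 (41)] -/
def certList : List (ℕ × ℕ × ℕ) :=
  [(61, 60, 8), (1321, 60, 37), (179951, 59, 425), (59, 58, 8), (3033169, 58, 1742), (32377, 57, 180),
   (1212847, 57, 1102), (15790321, 56, 3974), (881, 55, 30), (3191, 55, 57), (201961, 55, 450), (87211, 54, 296),
   (6361, 53, 80), (69431, 53, 264), (20394401, 53, 4517), (53, 52, 8), (157, 52, 13), (1613, 52, 41),
   (103, 51, 11), (2143, 51, 47), (11119, 51, 106), (251, 50, 16), (4051, 50, 64), (97, 48, 10),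
   (673, 48, 26), (2351, 47, 49), (4513, 47, 68), (13264529, 47, 3643), (2796203, 46, 1673), (631, 45, 26),
   (23311, 45, 153), (397, 44, 20), (2113, 44, 46), (431, 43, 21), (9719, 43, 99), (2099863, 43, 1450),
   (5419, 42, 74), (13367, 41, 116), (164511353, 41, 12827), (61681, 40, 249), (79, 39, 9), (121369, 39, 349),
   (174763, 38, 419), (223, 37, 15), (616318177, 37, 24826), (37, 36, 7), (109, 36, 11), (71, 35, 9),
   (122921, 35, 351), (43691, 34, 210), (599479, 33, 775), (65537, 32, 257), (2147483647, 31, 46341), (331, 30, 19),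
   (233, 29, 16), (1103, 29, 34), (2089, 29, 46), (29, 28, 6), (113, 28, 11), (262657, 27, 513),
   (2731, 26, 53), (601, 25, 25), (1801, 25, 43), (241, 24, 16), (47, 23, 7), (178481, 23, 423),
   (683, 22, 27), (337, 21, 19), (41, 20, 7), (524287, 19, 725), (19, 18, 5), (131071, 17, 363),
   (257, 16, 17), (151, 15, 13), (43, 14, 7), (8191, 13, 91), (13, 12, 4), (23, 11, 5),
   (89, 11, 10), (11, 10, 4), (73, 9, 9), (17, 8, 5), (127, 7, 12), (31, 5, 6),
   (5, 4, 3), (7, 3, 3), (3, 2, 2)]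

/-- The rough cofactors `(F, ν)`: `F` has no prime factor `< 16384` and `F < 16384^{ν+1}` (so at most `ν` prime
factors, each `≥ 16384`). [folklore] -/
def roughList : List (ℕ × ℕ) := [(4432676798593, 3), (3203431780337, 2)]

/-- `atomTable[e-1]` = a factorisation of `2^e − 1` (`1 ≤ e ≤ 60`) into members of `certList` and `roughList`
(with multiplicity). [folklore] -/
def atomTable : List (List ℕ) :=
  [[],
   [3],
   [7],
   [3, 5],
   [31],
   [3, 3, 7],
   [127],
   [3, 5, 17],
   [7, 73],
   [3, 11, 31],
   [23, 89],
   [3, 3, 5, 7, 13],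
   [8191],
   [3, 43, 127],
   [7, 31, 151],
   [3, 5, 17, 257],
   [131071],
   [3, 3, 3, 7, 19, 73],
   [524287],
   [3, 5, 5, 11, 31, 41],
   [7, 7, 127, 337],
   [3, 23, 89, 683],
   [47, 178481],
   [3, 3, 5, 7, 13, 17, 241],
   [31, 601, 1801],
   [3, 2731, 8191],
   [7, 73, 262657],
   [3, 5, 29, 43, 113, 127],
   [233, 1103, 2089],
   [3, 3, 7, 11, 31, 151, 331],
   [2147483647],
   [3, 5, 17, 257, 65537],
   [7, 23, 89, 599479],
   [3, 43691, 131071],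
   [31, 71, 127, 122921],
   [3, 3, 3, 5, 7, 13, 19, 37, 73, 109],
   [223, 616318177],
   [3, 174763, 524287],
   [7, 79, 8191, 121369],
   [3, 5, 5, 11, 17, 31, 41, 61681],
   [13367, 164511353],
   [3, 3, 7, 7, 43, 127, 337, 5419],
   [431, 9719, 2099863],
   [3, 5, 23, 89, 397, 683, 2113],
   [7, 31, 73, 151, 631, 23311],
   [3, 47, 178481, 2796203],
   [2351, 4513, 13264529],
   [3, 3, 5, 7, 13, 17, 97, 241, 257, 673],
   [127, 4432676798593],
   [3, 11, 31, 251, 601, 1801, 4051],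
   [7, 103, 2143, 11119, 131071],
   [3, 5, 53, 157, 1613, 2731, 8191],
   [6361, 69431, 20394401],
   [3, 3, 3, 3, 7, 19, 73, 87211, 262657],
   [23, 31, 89, 881, 3191, 201961],
   [3, 5, 17, 29, 43, 113, 127, 15790321],
   [7, 32377, 524287, 1212847],
   [3, 59, 233, 1103, 2089, 3033169],
   [179951, 3203431780337],
   [3, 3, 5, 5, 7, 11, 13, 31, 41, 61, 151, 331, 1321]]

/-- Upper table for the head: `headTab[x-1] ≥ (16383/16382)^5 · headRec x certPE 1` (`1 ≤ x ≤ 60`), seven decimals.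
[folklore] -/
def headTab : List ℚ :=
  [(5001527 : ℚ) / 5000000, (20006107 : ℚ) / 10000000, (22006717 : ℚ) / 10000000, (28675419 : ℚ) / 10000000,
   (453443 : ℚ) / 156250, (15510481 : ℚ) / 5000000, (15550493 : ℚ) / 5000000, (32879307 : ℚ) / 10000000,
   (33048373 : ℚ) / 10000000, (17846429 : ℚ) / 5000000, (18144823 : ℚ) / 5000000, (20266683 : ℚ) / 5000000,
   (40534587 : ℚ) / 10000000, (41106469 : ℚ) / 10000000, (8251759 : ℚ) / 2000000, (5171297 : ℚ) / 1250000,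
   (10342613 : ℚ) / 2500000, (10742901 : ℚ) / 2500000, (42971623 : ℚ) / 10000000, (44754267 : ℚ) / 10000000,
   (4480639 : ℚ) / 1000000, (45434309 : ℚ) / 10000000, (45656657 : ℚ) / 10000000, (46362167 : ℚ) / 10000000,
   (9277041 : ℚ) / 2000000, (23196879 : ℚ) / 5000000, (11598451 : ℚ) / 2500000, (4788859 : ℚ) / 1000000,
   (11986459 : ℚ) / 2500000, (4866103 : ℚ) / 1000000, (4866103 : ℚ) / 1000000, (9732293 : ℚ) / 2000000,
   (12195211 : ℚ) / 2500000, (48781379 : ℚ) / 10000000, (9787079 : ℚ) / 2000000, (25585871 : ℚ) / 5000000,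
   (10243401 : ℚ) / 2000000, (25608569 : ℚ) / 5000000, (25686697 : ℚ) / 5000000, (2067683 : ℚ) / 400000,
   (6461603 : ℚ) / 1250000, (5184967 : ℚ) / 1000000, (6484253 : ℚ) / 1250000, (52367369 : ℚ) / 10000000,
   (52395071 : ℚ) / 10000000, (26308713 : ℚ) / 5000000, (52623903 : ℚ) / 10000000, (2655541 : ℚ) / 500000,
   (2655541 : ℚ) / 500000, (415916 : ℚ) / 78125, (26681433 : ℚ) / 5000000, (5408197 : ℚ) / 1000000,
   (6760461 : ℚ) / 1250000, (10816807 : ℚ) / 2000000, (27060293 : ℚ) / 5000000, (54263701 : ℚ) / 10000000,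
   (10852817 : ℚ) / 2000000, (54674331 : ℚ) / 10000000, (27337193 : ℚ) / 5000000, (14105183 : ℚ) / 2500000]



/-- The rough-cofactor loss factor `(16383/16382)^5`. [folklore] -/
def rfQ : ℚ := ((16383 : ℚ) / 16382) ^ 5

/-- The certified primes as a `Finset`. [folklore] -/
def Cset : Finset ℕ := (certList.map Prod.fst).toFinset

/-- The primes of the rough cofactors. [folklore] -/
def RSet : Finset ℕ := (roughList.map Prod.fst).toFinset.biUnion Nat.primeFactors

/-- Kernel check of the atom table: `∏ atomTable[e-1] = 2^e − 1` and every atom is certified or rough. [folklore] -/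
def atomCheck : Bool :=
  (List.range 60).all fun i =>
    decide ((atomTable.getD i []).prod = 2 ^ (i + 1) - 1) &&
      (atomTable.getD i []).all fun a =>
        decide (a ∈ certList.map Prod.fst) || decide (a ∈ roughList.map Prod.fst)

/-- Kernel check of the head table on `x ∈ [lo, lo + n)`: `rfQ · headRec x ≤ headTab[x-1]`. [folklore] -/
def headOK (lo n : ℕ) : Bool :=
  (List.range n).all fun i => decide (rfQ * headRec (lo + i) certList 1 ≤ headTab.getD (lo + i - 1) 0)

/-- Chunk bounds for `∏_{p odd prime} p/(p−1)` over `p ≤ 2^11 − 1`, `(2^11, 2^12)`, …, `(3·2^13, 2^15)`. [folklore] -/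
def cb0 : ℚ := 34035299 / 5000000
/-- [folklore] -/ def cb1 : ℚ := 2181019 / 2000000
/-- [folklore] -/ def cb2 : ℚ := 10820363 / 10000000
/-- [folklore] -/ def cb3 : ℚ := 10769049 / 10000000
/-- [folklore] -/ def cb4 : ℚ := 10416587 / 10000000
/-- [folklore] -/ def cb5 : ℚ := 5140083 / 5000000

/-- `pk(K) ≥ ∏_{3 ≤ p ≤ 2^K − 1} p/(p−1)` for `K ∈ [11, 15]`. [folklore] -/
def pkQ (K : ℕ) : ℚ :=
  if K ≤ 11 then cb0 else if K ≤ 12 then cb0 * cb1 else if K ≤ 13 then cb0 * cb1 * cb2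
  else if K ≤ 14 then cb0 * cb1 * cb2 * cb3 else cb0 * cb1 * cb2 * cb3 * cb4 * cb5

/-- `1/0.65828 ≥ C₀⁻¹`. [folklore] -/
def c0iQ : ℚ := 100000 / 65828

/-- The table parameter `K(x)`. [folklore] -/
def Kof (x : ℕ) : ℕ := if x ≤ 84 then 11 else if x ≤ 119 then 12 else if x ≤ 171 then 13 else if x ≤ 242 then 14 else 15

/-- The table row `U(x) = C₀⁻¹ · pk(K) · (2^K/(2^K−1))^{⌊x(x+1)/2/K⌋}`, `K = K(x)`. [folklore] -/
def rowU (x : ℕ) : ℚ :=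
  c0iQ * pkQ (Kof x) * ((2 : ℚ) ^ Kof x / ((2 : ℚ) ^ Kof x - 1)) ^ (x * (x + 1) / 2 / Kof x)

/-- The majorant for `x ≤ 255`: head table for `x ≤ 60`, table row beyond. [folklore] -/
def uQ (x : ℕ) : ℚ := if x ≤ 60 then headTab.getD (x - 1) 0 else rowU x

/-- `U(x)/(x(x+1))`. [folklore] -/
def termQ (x : ℕ) : ℚ := uQ x / ((x : ℚ) * ((x : ℚ) + 1))

/-- Upper bound for `∑_{x ≤ 255} U(x)/(x(x+1))`. [folklore] -/
def HTupQ : ℚ := 497039 / 250000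

/-- The far-range constant `A₁ = C₀⁻¹ · pk(15) · (1 − 0.07912)⁻¹ · 17/240`. [folklore] -/
def A1Q : ℚ := c0iQ * pkQ 15 * (1 / (1 - 989 / 12500)) * (17 / 240)

/-! ### §8 Kernel verifications (`decide +kernel`; a few minutes in total) -/

set_option maxHeartbeats 40000000 in
/-- The prime list is certified (primality, `p > 2`, orders). [folklore] -/
theorem certList_ok : certListOK certList = true := by
  decide +kernel

set_option maxHeartbeats 40000000 in
/-- The certified primes are distinct. [folklore] -/
theorem certList_nodup : (certList.map Prod.fst).Nodup := by
  decide +kernel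

set_option maxHeartbeats 40000000 in
/-- The rough cofactors are certified rough. [folklore] -/
theorem roughList_ok : (roughList.all fun t => roughCert t.1 t.2) = true := by
  decide +kernel

set_option maxHeartbeats 40000000 in
/-- The atom table is consistent. [folklore] -/
theorem atomCheck_ok : atomCheck = true := by
  decide +kernel

set_option maxHeartbeats 40000000 in
/-- Head table, `x ∈ [1, 44]`. [folklore] -/
theorem headOK_1 : headOK 1 44 = true := by
  decide +kernel

set_option maxHeartbeats 40000000 in
/-- Head table, `x ∈ [45, 51]`. [folklore] -/
theorem headOK_2 : headOK 45 7 = true := by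
  decide +kernel

set_option maxHeartbeats 40000000 in
/-- Head table, `x ∈ [52, 56]`. [folklore] -/
theorem headOK_3 : headOK 52 5 = true := by
  decide +kernel

set_option maxHeartbeats 40000000 in
/-- Head table, `x ∈ [57, 60]`. [folklore] -/
theorem headOK_4 : headOK 57 4 = true := by
  decide +kernel

set_option maxHeartbeats 40000000 in
/-- `∏_{3 ≤ p ≤ 2047} p/(p−1) ≤ cb0`. [folklore] -/
theorem chunk0 : ppQ 3 1023 ≤ cb0 := by
  decide +kernel

set_option maxHeartbeats 40000000 in
/-- [folklore] -/
theorem chunk1 : ppQ 2049 1024 ≤ cb1 := by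
  decide +kernel

set_option maxHeartbeats 40000000 in
/-- [folklore] -/
theorem chunk2 : ppQ 4097 2048 ≤ cb2 := by
  decide +kernel

set_option maxHeartbeats 40000000 in
/-- [folklore] -/
theorem chunk3 : ppQ 8193 4096 ≤ cb3 := by
  decide +kernel

set_option maxHeartbeats 40000000 in
/-- [folklore] -/
theorem chunk4 : ppQ 16385 4096 ≤ cb4 := by
  decide +kernel

set_option maxHeartbeats 40000000 in
/-- [folklore] -/
theorem chunk5 : ppQ 24577 4096 ≤ cb5 := by
  decide +kernel

set_option maxHeartbeats 40000000 in
/-- `∑_{x=1}^{255} U(x)/(x(x+1)) ≤ 1.988156`. [folklore] -/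
theorem htSum_ok : ((List.range 255).map fun i => termQ (i + 1)).sum ≤ HTupQ := by
  decide +kernel

set_option maxHeartbeats 40000000 in
/-- The final numerical inequality `1.988156 + A₁ · T(8) ≤ 2.071`. [folklore] -/
theorem final_ineq : HTupQ + A1Q * (121277 / 1600000) ≤ 2071 / 1000 := by
  decide +kernel

/-! ### §9 Soundness of the certificates -/

/-- The certified primes are odd primes with the listed orders. [folklore] -/
theorem certList_certPrimes : CertPrimes certList := certPrimes_of_certListOK certList_ok

/-- `Cset` is a set of odd primes. [folklore] -/
theorem primeSet_Cset : PrimeSet Cset := primeSet_of_certPrimes certList_certPrimes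

/-- The rough cofactors: positive, all prime factors `≥ 16384`, at most `ν` of them. [folklore] -/
theorem roughList_sound : ∀ t ∈ roughList,
    0 < t.1 ∧ (∀ q ∈ t.1.primeFactors, 16384 ≤ q) ∧ t.1.primeFactors.card ≤ t.2 := by
  intro t ht
  have h := roughList_ok
  rw [List.all_eq_true] at h
  exact roughCert_sound (h t ht)

/-- Members of `RSet` are primes `≥ 16384`. [folklore] -/
theorem RSet_spec : ∀ q ∈ RSet, q.Prime ∧ 16384 ≤ q := by
  intro q hq
  rw [RSet, Finset.mem_biUnion] at hq
  obtain ⟨F, hF, hqF⟩ := hq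
  rw [List.mem_toFinset, List.mem_map] at hF
  obtain ⟨t, ht, rfl⟩ := hF
  exact ⟨Nat.prime_of_mem_primeFactors hqF, (roughList_sound t ht).2.1 q hqF⟩

/-- `RSet` is a set of odd primes. [folklore] -/
theorem primeSet_RSet : PrimeSet RSet := fun q hq =>
  ⟨(RSet_spec q hq).1, by have := (RSet_spec q hq).2; omega⟩

/-- `|RSet| ≤ 5`. [folklore] -/
theorem RSet_card : RSet.card ≤ 5 := by
  have h1 := (roughList_sound (4432676798593, 3) (by simp [roughList])).2.2
  have h2 := (roughList_sound (3203431780337, 2) (by simp [roughList])).2.2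
  have hR : RSet = (4432676798593 : ℕ).primeFactors ∪ (3203431780337 : ℕ).primeFactors := by
    simp [RSet, roughList]
  rw [hR]
  exact (Finset.card_union_le _ _).trans (by simp only at h1 h2; omega)

/-- Soundness of the atom table. [folklore] -/
theorem atomCheck_sound {k : ℕ} (hk1 : 1 ≤ k) (hk : k ≤ 60) :
    (atomTable.getD (k - 1) []).prod = 2 ^ k - 1 ∧
      ∀ a ∈ atomTable.getD (k - 1) [], a ∈ certList.map Prod.fst ∨ a ∈ roughList.map Prod.fst := by
  have h := atomCheck_ok
  simp only [atomCheck, List.all_eq_true, List.mem_range, Bool.and_eq_true, decide_eq_true_eq,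
    Bool.or_eq_true] at h
  obtain ⟨h1, h2⟩ := h (k - 1) (by omega)
  rw [show k - 1 + 1 = k by omega] at h1
  exact ⟨h1, h2⟩

/-- A prime dividing a list product divides a member. [folklore] -/
theorem exists_dvd_of_dvd_list_prod {p : ℕ} (hp : p.Prime) :
    ∀ l : List ℕ, p ∣ l.prod → ∃ a ∈ l, p ∣ a
  | [], h => by
      rw [List.prod_nil] at h
      exact absurd (Nat.dvd_one.1 h) hp.one_lt.ne'
  | a :: l, h => by
      rw [List.prod_cons] at h
      rcases (Nat.Prime.dvd_mul hp).1 h with h | h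
      · exact ⟨a, List.mem_cons_self, h⟩
      · obtain ⟨b, hb, hbd⟩ := exists_dvd_of_dvd_list_prod hp l h
        exact ⟨b, List.mem_cons_of_mem a hb, hbd⟩

/-- **Coverage**: every prime factor of `D(x)`, `x ≤ 60`, is a certified prime or a prime of a rough
cofactor. [folklore] -/
theorem mem_Cset_union_RSet {x : ℕ} (hx : x ≤ 60) {p : ℕ} (hp : p.Prime) (hdvd : p ∣ romanovD x) :
    p ∈ Cset ∪ RSet := by
  rw [romanovD] at hdvd
  obtain ⟨k, hk, hpk⟩ := (Nat.prime_iff.1 hp).exists_mem_finset_dvd hdvd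
  have hk1 : 1 ≤ k := (Finset.mem_Icc.1 hk).1
  have hkx : k ≤ 60 := (Finset.mem_Icc.1 hk).2.trans hx
  obtain ⟨hprod, hmem⟩ := atomCheck_sound hk1 hkx
  rw [← hprod] at hpk
  obtain ⟨a, ha, hpa⟩ := exists_dvd_of_dvd_list_prod hp _ hpk
  rcases hmem a ha with h | h
  · have haP : a.Prime := by
      rw [List.mem_map] at h
      obtain ⟨t, ht, rfl⟩ := h
      exact (certList_certPrimes t ht).1
    have : p = a := (Nat.prime_dvd_prime_iff_eq hp haP).1 hpa
    subst this
    exact Finset.mem_union_left _ (List.mem_toFinset.2 h)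
  · refine Finset.mem_union_right _ ?_
    rw [RSet, Finset.mem_biUnion]
    refine ⟨a, List.mem_toFinset.2 h, ?_⟩
    have ha0 : a ≠ 0 := by
      rw [List.mem_map] at h
      obtain ⟨t, ht, rfl⟩ := h
      exact (roughList_sound t ht).1.ne'
    exact Nat.mem_primeFactors.2 ⟨hp, hpa, ha0⟩

/-- The prime factors of an odd `t ≠ 0` with `ξ(t) ≤ x ≤ 60` are covered. [folklore] -/
theorem primeFactors_subset_cover {x : ℕ} (hx : x ≤ 60) (t : ℕ) (ht0 : t ≠ 0) (hodd : Odd t)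
    (hord : ordTwo t ≤ x) : t.primeFactors ⊆ Cset ∪ RSet := by
  intro q hq
  have hqP := Nat.prime_of_mem_primeFactors hq
  have hqt := Nat.dvd_of_mem_primeFactors hq
  have hq2 := two_lt_of_mem_primeFactors_odd hodd hq
  have hqodd : Odd q := hqP.odd_of_ne_two (by omega)
  have hoq : ordTwo q ≤ x :=
    (Nat.le_of_dvd (ordTwo_pos hodd) (ordTwo_dvd_ordTwo_of_dvd hqt)).trans hord
  have _ := ht0
  exact mem_Cset_union_RSet hx hqP (dvd_romanovD_of_ordTwo_le hqodd hoq)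

/-- **Head bound, abstract**: `E(x) ≤ (16383/16382)^5 · headRec x` for `x ≤ 60`.
[cite: HeathbrownPuchta2002, §5 (41)] -/
theorem head_bound (s : Finset ℕ) {x : ℕ} (hx : x ≤ 60) :
    ∑ t ∈ s with ordTwo t ≤ x, fq 1 t ≤ ((rfQ * headRec x certList 1 : ℚ) : ℝ) := by
  have hC : PrimeSet Cset := primeSet_Cset
  have hR : PrimeSet RSet := primeSet_RSet
  have hCR : PrimeSet (Cset ∪ RSet) := by
    intro p hp
    rcases Finset.mem_union.1 hp with h | h
    · exact hC p h
    · exact hR p h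
  have h1 := sum_filter_ordTwo_le_Phi s hCR (fun t ht0 hodd hord => primeFactors_subset_cover hx t ht0 hodd hord)
  have h2 := Phi_union_le (x := x) hC RSet hR 1 one_ne_zero
  have h3 : ∏ q ∈ RSet, (1 + 1 / ((q : ℝ) - 2)) ≤ ((rfQ : ℚ) : ℝ) := by
    have hf : ∀ q ∈ RSet, (1 + 1 / ((q : ℝ) - 2)) ≤ 16383 / 16382 := by
      intro q hq
      have hq' : (16384 : ℝ) ≤ q := by exact_mod_cast (RSet_spec q hq).2
      rw [show (16383 : ℝ) / 16382 = 1 + 1 / 16382 by norm_num]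
      exact add_le_add (le_refl _) (one_div_le_one_div_of_le (by norm_num) (by linarith))
    have hf0 : ∀ q ∈ RSet, 0 ≤ (1 + 1 / ((q : ℝ) - 2)) := by
      intro q hq
      have hq' : (16384 : ℝ) ≤ q := by exact_mod_cast (RSet_spec q hq).2
      exact add_nonneg zero_le_one (le_of_lt (one_div_pos.2 (by linarith)))
    calc ∏ q ∈ RSet, (1 + 1 / ((q : ℝ) - 2)) ≤ ∏ _q ∈ RSet, ((16383 : ℝ) / 16382) :=
          Finset.prod_le_prod hf0 hf
      _ = ((16383 : ℝ) / 16382) ^ RSet.card := Finset.prod_const _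
      _ ≤ ((16383 : ℝ) / 16382) ^ 5 := pow_le_pow_right₀ (by norm_num) RSet_card
      _ = ((rfQ : ℚ) : ℝ) := by rw [rfQ]; push_cast; ring
  have h4 : Phi x Cset 1 = ((headRec x certList 1 : ℚ) : ℝ) :=
    (headRec_eq_Phi x certList certList_certPrimes certList_nodup 1 one_ne_zero).symm
  have hPhi0 : 0 ≤ Phi x Cset 1 := Phi_nonneg hC 1
  calc ∑ t ∈ s with ordTwo t ≤ x, fq 1 t ≤ Phi x (Cset ∪ RSet) 1 := h1
    _ ≤ (∏ q ∈ RSet, (1 + 1 / ((q : ℝ) - 2))) * Phi x Cset 1 := h2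
    _ ≤ ((rfQ : ℚ) : ℝ) * Phi x Cset 1 := mul_le_mul_of_nonneg_right h3 hPhi0
    _ = _ := by rw [h4]; push_cast; ring

/-- The head table dominates: `rfQ · headRec x ≤ headTab[x-1]` for `1 ≤ x ≤ 60` (kernel). [folklore] -/
theorem head_cert {x : ℕ} (h1 : 1 ≤ x) (h2 : x ≤ 60) :
    rfQ * headRec x certList 1 ≤ headTab.getD (x - 1) 0 := by
  have H : ∀ lo n, headOK lo n = true → ∀ i, i < n →
      rfQ * headRec (lo + i) certList 1 ≤ headTab.getD (lo + i - 1) 0 := by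
    intro lo n h i hi
    simp only [headOK, List.all_eq_true, List.mem_range, decide_eq_true_eq] at h
    exact h i hi
  by_cases c1 : x ≤ 44
  · have := H 1 44 headOK_1 (x - 1) (by omega); rwa [show 1 + (x - 1) = x by omega] at this
  by_cases c2 : x ≤ 51
  · have := H 45 7 headOK_2 (x - 45) (by omega); rwa [show 45 + (x - 45) = x by omega] at this
  by_cases c3 : x ≤ 56
  · have := H 52 5 headOK_3 (x - 52) (by omega); rwa [show 52 + (x - 52) = x by omega] at this
  · have := H 57 4 headOK_4 (x - 57) (by omega); rwa [show 57 + (x - 57) = x by omega] at this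

/-- **Head**: `E(x) ≤ headTab[x-1]` for `1 ≤ x ≤ 60`. [cite: HeathbrownPuchta2002, §5 (41)] -/
theorem head_U (s : Finset ℕ) {x : ℕ} (h1 : 1 ≤ x) (h2 : x ≤ 60) :
    ∑ t ∈ s with ordTwo t ≤ x, fq 1 t ≤ ((headTab.getD (x - 1) 0 : ℚ) : ℝ) :=
  (head_bound s h2).trans (by exact_mod_cast head_cert h1 h2)

/-- `g ≥ 0` in `ℚ`. [folklore] -/
theorem gQ_nonneg (m : ℕ) : 0 ≤ gQ m := by
  unfold gQ
  split_ifs with h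
  · have h2 : 2 ≤ m := by
      simp only [tdPrime, Bool.and_eq_true, decide_eq_true_eq] at h
      exact h.1
    have h2' : (2 : ℚ) ≤ m := by exact_mod_cast h2
    exact div_nonneg (by linarith) (by linarith)
  · exact zero_le_one

/-- `ppQ ≥ 0`. [folklore] -/
theorem ppQ_nonneg (a n : ℕ) : 0 ≤ ppQ a n := by
  rw [ppQ_eq]; exact Finset.prod_nonneg fun i _ => gQ_nonneg _

/-- Chunking in `ℚ`. [folklore] -/
theorem ppQ_add (a N₁ N₂ : ℕ) : ppQ a (N₁ + N₂) = ppQ a N₁ * ppQ (a + 2 * N₁) N₂ := by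
  rw [ppQ_eq, ppQ_eq, ppQ_eq, Finset.prod_range_add]
  congr 1
  refine Finset.prod_congr rfl fun i _ => ?_
  rw [show a + 2 * (N₁ + i) = a + 2 * N₁ + 2 * i by ring]

/-- **`∏_{3 ≤ p ≤ 2^K−1} p/(p−1) ≤ pk(K)`** for `K ∈ [11, 15]` (kernel chunks). [folklore] -/
theorem ppQ3_le_pkQ : ∀ K, 11 ≤ K → K ≤ 15 → ppQ 3 (2 ^ (K - 1) - 1) ≤ pkQ K := by
  have n0 : 0 ≤ cb0 := by rw [cb0]; norm_num
  have n1 : 0 ≤ cb1 := by rw [cb1]; norm_num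
  have n2 : 0 ≤ cb2 := by rw [cb2]; norm_num
  have n3 : 0 ≤ cb3 := by rw [cb3]; norm_num
  have n4 : 0 ≤ cb4 := by rw [cb4]; norm_num
  have l11 : ppQ 3 1023 ≤ cb0 := chunk0
  have l12 : ppQ 3 2047 ≤ cb0 * cb1 := by
    rw [show (2047 : ℕ) = 1023 + 1024 by norm_num, ppQ_add]
    exact mul_le_mul l11 chunk1 (ppQ_nonneg _ _) n0
  have l13 : ppQ 3 4095 ≤ cb0 * cb1 * cb2 := by
    rw [show (4095 : ℕ) = 2047 + 2048 by norm_num, ppQ_add]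
    exact mul_le_mul l12 chunk2 (ppQ_nonneg _ _) (mul_nonneg n0 n1)
  have l14 : ppQ 3 8191 ≤ cb0 * cb1 * cb2 * cb3 := by
    rw [show (8191 : ℕ) = 4095 + 4096 by norm_num, ppQ_add]
    exact mul_le_mul l13 chunk3 (ppQ_nonneg _ _) (mul_nonneg (mul_nonneg n0 n1) n2)
  have l15a : ppQ 3 12287 ≤ cb0 * cb1 * cb2 * cb3 * cb4 := by
    rw [show (12287 : ℕ) = 8191 + 4096 by norm_num, ppQ_add]
    exact mul_le_mul l14 chunk4 (ppQ_nonneg _ _) (mul_nonneg (mul_nonneg (mul_nonneg n0 n1) n2) n3)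
  have l15 : ppQ 3 16383 ≤ cb0 * cb1 * cb2 * cb3 * cb4 * cb5 := by
    rw [show (16383 : ℕ) = 12287 + 4096 by norm_num, ppQ_add]
    exact mul_le_mul l15a chunk5 (ppQ_nonneg _ _)
      (mul_nonneg (mul_nonneg (mul_nonneg (mul_nonneg n0 n1) n2) n3) n4)
  intro K hK1 hK2
  interval_cases K
  · rw [pkQ, if_pos le_rfl]; exact l11
  · rw [pkQ, if_neg (by norm_num), if_pos le_rfl]; exact l12
  · rw [pkQ, if_neg (by norm_num), if_neg (by norm_num), if_pos le_rfl]; exact l13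
  · rw [pkQ, if_neg (by norm_num), if_neg (by norm_num), if_neg (by norm_num), if_pos le_rfl]; exact l14
  · rw [pkQ, if_neg (by norm_num), if_neg (by norm_num), if_neg (by norm_num), if_neg (by norm_num)]; exact l15

/-- **Table bound for a parameter `K ∈ [11, 15]`**:
`E(x) ≤ C₀⁻¹ · pk(K) · (2^K/(2^K − 1))^{⌊x(x+1)/2/K⌋}`. [cite: HeathbrownPuchta2002, §5 (41)] -/
theorem table_bound_K (s : Finset ℕ) (x K : ℕ) (hK : 11 ≤ K ∧ K ≤ 15) :
    ∑ t ∈ s with ordTwo t ≤ x, fq 1 t ≤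
      ((c0iQ * pkQ K * ((2 : ℚ) ^ K / ((2 : ℚ) ^ K - 1)) ^ (x * (x + 1) / 2 / K) : ℚ) : ℝ) := by
  have h2K : 2 ^ 11 ≤ 2 ^ K := Nat.pow_le_pow_right (by norm_num) hK.1
  have hKm : 2 ^ K = 2 * 2 ^ (K - 1) := by rw [← pow_succ']; congr 1; omega
  have hy1 : 1 ≤ 2 ^ K - 1 := by omega
  have hlt : romanovD x < (2 ^ K - 1 + 1) ^ (x * (x + 1) / 2 / K + 1) := romanovD_lt_two_pow_mul x (by omega)
  have h0 := sum_filter_ordTwo_le_tail s x hy1 hlt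
  have hprod : ∏ p ∈ (romanovD x).primeFactors with p ≤ 2 ^ K - 1, (p : ℝ) / ((p : ℝ) - 1) ≤
      ((pkQ K : ℚ) : ℝ) := by
    calc _ ≤ PP (2 ^ (K - 1) - 1) := by
          refine prod_div_pred_le_PP _ _ fun p hp => ?_
          have hp' := Finset.mem_filter.1 hp
          exact ⟨Nat.prime_of_mem_primeFactors hp'.1, two_lt_of_mem_primeFactors_odd (odd_romanovD x) hp'.1,
            by omega⟩
      _ = ((ppQ 3 (2 ^ (K - 1) - 1) : ℚ) : ℝ) := PP_eq_ppQ _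
      _ ≤ ((pkQ K : ℚ) : ℝ) := by exact_mod_cast ppQ3_le_pkQ K hK.1 hK.2
  have hC : (0.65828 : ℝ) ≤ twinPrimeConst := twinPrimeConst_ge
  have hCi : twinPrimeConst⁻¹ ≤ ((c0iQ : ℚ) : ℝ) := by
    rw [c0iQ]; push_cast
    calc twinPrimeConst⁻¹ ≤ (0.65828 : ℝ)⁻¹ := inv_anti₀ (by norm_num) hC
      _ = 100000 / 65828 := by norm_num
  have hc0 : 0 ≤ ((c0iQ : ℚ) : ℝ) := by rw [c0iQ]; push_cast; norm_num
  have hyR : (((2 ^ K - 1 : ℕ) : ℝ)) = (2 : ℝ) ^ K - 1 := by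
    rw [Nat.cast_sub Nat.one_le_two_pow]; push_cast; ring
  have hpow0 : 0 ≤ ((((2 ^ K - 1 : ℕ) : ℝ) + 1) / ((2 ^ K - 1 : ℕ) : ℝ)) ^ (x * (x + 1) / 2 / K) :=
    pow_nonneg (div_nonneg (by rw [hyR]; norm_num) (Nat.cast_nonneg _)) _
  have hP0 : 0 ≤ ∏ p ∈ (romanovD x).primeFactors with p ≤ 2 ^ K - 1, (p : ℝ) / ((p : ℝ) - 1) :=
    Finset.prod_nonneg fun p hp => by
      have h2 : 2 < p := two_lt_of_mem_primeFactors_odd (odd_romanovD x) (Finset.mem_filter.1 hp).1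
      have h2' : (2 : ℝ) < p := by exact_mod_cast h2
      exact (div_pos (by linarith) (by linarith)).le
  have hrow : ((c0iQ * pkQ K * ((2 : ℚ) ^ K / ((2 : ℚ) ^ K - 1)) ^ (x * (x + 1) / 2 / K) : ℚ) : ℝ) =
      ((c0iQ : ℚ) : ℝ) * (((pkQ K : ℚ) : ℝ) *
        ((((2 ^ K - 1 : ℕ) : ℝ) + 1) / ((2 ^ K - 1 : ℕ) : ℝ)) ^ (x * (x + 1) / 2 / K)) := by
    rw [hyR]; push_cast; ring
  rw [hrow]
  calc _ ≤ _ := h0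
    _ ≤ ((c0iQ : ℚ) : ℝ) * (((pkQ K : ℚ) : ℝ) *
        ((((2 ^ K - 1 : ℕ) : ℝ) + 1) / ((2 ^ K - 1 : ℕ) : ℝ)) ^ (x * (x + 1) / 2 / K)) :=
        mul_le_mul hCi (mul_le_mul_of_nonneg_right hprod hpow0) (mul_nonneg hP0 hpow0) hc0

/-- `K(x) ∈ [11, 15]`. [folklore] -/
theorem Kof_mem (x : ℕ) : 11 ≤ Kof x ∧ Kof x ≤ 15 := by
  unfold Kof; split_ifs <;> omega

/-- **Table**: `E(x) ≤ rowU x` (all `x`). [cite: HeathbrownPuchta2002, §5 (41)] -/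
theorem table_bound (s : Finset ℕ) (x : ℕ) : ∑ t ∈ s with ordTwo t ≤ x, fq 1 t ≤ ((rowU x : ℚ) : ℝ) :=
  table_bound_K s x (Kof x) (Kof_mem x)

/-! ### §10 The far-range sum -/

/-- `g(j) = K (1 + k (K − 15))`, `K = 2j+1`, `k = 0.0722/15 = 361/75000`. [folklore] -/
noncomputable def gfun (j : ℕ) : ℝ := ((2 * j + 1 : ℕ) : ℝ) * (1 + 361 / 75000 * (((2 * j + 1 : ℕ) : ℝ) - 15))

/-- `T(j) = ∑_{i ≥ j} g(i)/2^{i+1} = ((3 − 28k) + (2 − 18k) j + 4k j²)/2^j`. [folklore] -/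
noncomputable def TjR (j : ℕ) : ℝ :=
  ((3 - 28 * (361 / 75000 : ℝ)) + (2 - 18 * (361 / 75000 : ℝ)) * j + 4 * (361 / 75000 : ℝ) * (j : ℝ) ^ 2) / 2 ^ j

/-- `T(j) − T(j+1) = g(j)/2^{j+1}`. [folklore] -/
theorem TjR_sub (j : ℕ) : TjR j - TjR (j + 1) = gfun j / 2 ^ (j + 1) := by
  rw [TjR, TjR, gfun, pow_succ]
  have h2 : (0 : ℝ) < 2 ^ j := by positivity
  push_cast
  field_simp
  ring

/-- `g(J)/2^{J+1} ≤ T(J+1)` (`g` is increasing). [folklore] -/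
theorem gfun_div_le_TjR (J : ℕ) : gfun J / 2 ^ (J + 1) ≤ TjR (J + 1) := by
  rw [TjR, gfun]
  refine div_le_div_of_nonneg_right ?_ (by positivity)
  push_cast
  nlinarith [Nat.cast_nonneg (α := ℝ) J]

/-- `T(8) = 121277/1600000`. [folklore] -/
theorem TjR_eight : TjR 8 = 121277 / 1600000 := by
  rw [TjR]; norm_num

/-- Telescoping: `∑_{j=8}^{J} g(j)/2^{j+1} = T(8) − T(J+1)`. [folklore] -/
theorem sum_gfun : ∀ J, 8 ≤ J → ∑ j ∈ Icc 8 J, gfun j / 2 ^ (j + 1) = TjR 8 - TjR (J + 1) := by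
  refine Nat.le_induction ?_ fun J hJ ih => ?_
  · rw [Finset.Icc_self, Finset.sum_singleton, TjR_sub]
  · rw [Finset.sum_Icc_succ_top (by omega), ih, ← TjR_sub]; ring

/-- `V(j) ≤ A₁ g(j)` for `j ≥ 8` (`C₀⁻¹ ≤ 1/0.65828`, `PP(16383) ≤ pk(15)`, `K/(K−1) ≤ 17/16`). [folklore] -/
theorem farV_le {j : ℕ} (hj : 8 ≤ j) : farV j ≤ ((A1Q : ℚ) : ℝ) * gfun j := by
  have hC : (0.65828 : ℝ) ≤ twinPrimeConst := twinPrimeConst_ge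
  have hCi : twinPrimeConst⁻¹ ≤ ((c0iQ : ℚ) : ℝ) := by
    rw [c0iQ]; push_cast
    calc twinPrimeConst⁻¹ ≤ (0.65828 : ℝ)⁻¹ := inv_anti₀ (by norm_num) hC
      _ = 100000 / 65828 := by norm_num
  have hc0 : 0 ≤ ((c0iQ : ℚ) : ℝ) := by rw [c0iQ]; push_cast; norm_num
  have hP : PP (2 ^ 14 - 1) ≤ ((pkQ 15 : ℚ) : ℝ) := by
    rw [PP_eq_ppQ]; exact_mod_cast ppQ3_le_pkQ 15 (by norm_num) le_rfl
  have hpk0 : 0 ≤ ((pkQ 15 : ℚ) : ℝ) := (PP_nonneg _).trans hP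
  have hK17 : (17 : ℝ) ≤ ((2 * j + 1 : ℕ) : ℝ) := by exact_mod_cast (show 17 ≤ 2 * j + 1 by omega)
  set K : ℝ := ((2 * j + 1 : ℕ) : ℝ) with hKdef
  have hKK : K / (K - 1) ≤ 17 / 16 := by
    rw [div_le_div_iff₀ (by linarith) (by norm_num)]; linarith
  have hKK0 : 0 ≤ K / (K - 1) := div_nonneg (by linarith) (by linarith)
  have hg : (K / 15) * (1 + 0.0722 * (K / 15 - 1)) = gfun j / 15 := by
    rw [gfun, ← hKdef]; ring
  have hg0 : 0 ≤ gfun j := by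
    rw [gfun, ← hKdef]; exact mul_nonneg (by linarith) (by nlinarith)
  have hE0 : (0 : ℝ) ≤ 1 / (1 - 0.07912) := by norm_num
  have hmid0 : 0 ≤ PP (2 ^ 14 - 1) * ((1 / (1 - 0.07912)) * (gfun j / 15)) :=
    mul_nonneg (PP_nonneg _) (mul_nonneg hE0 (by linarith))
  have hA : ((A1Q : ℚ) : ℝ) * gfun j =
      ((c0iQ : ℚ) : ℝ) * ((((pkQ 15 : ℚ) : ℝ) * ((1 / (1 - 0.07912)) * (gfun j / 15))) * (17 / 16)) := by
    rw [A1Q]; push_cast; ring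
  rw [farV, hA, hg]
  refine mul_le_mul hCi ?_ (mul_nonneg hmid0 hKK0) hc0
  refine mul_le_mul ?_ hKK hKK0 (mul_nonneg hpk0 (mul_nonneg hE0 (by linarith)))
  exact mul_le_mul_of_nonneg_right hP (mul_nonneg hE0 (by linarith))

/-- Block sum: `∑_{x ∈ [2^j, 2^{j+1})} 1/(x(x+1)) = 2^{−(j+1)}`. [folklore] -/
theorem sum_Ico_block (j : ℕ) :
    ∑ x ∈ Finset.Ico (2 ^ j : ℕ) (2 ^ (j + 1)), 1 / ((x : ℝ) * (x + 1)) = 1 / (2 : ℝ) ^ (j + 1) := by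
  have hX : 2 ^ (j + 1) - 1 + 1 = 2 ^ (j + 1) := Nat.sub_add_cancel Nat.one_le_two_pow
  have hle : 2 ^ j ≤ 2 ^ (j + 1) - 1 + 1 := by rw [hX, pow_succ]; omega
  have h := sum_Ico_inv_mul_succ (ξ := 2 ^ j) Nat.one_le_two_pow (2 ^ (j + 1) - 1) hle
  rw [hX] at h
  rw [h]
  have hc : ((2 ^ (j + 1) - 1 : ℕ) : ℝ) + 1 = (2 : ℝ) ^ (j + 1) := by
    rw [Nat.cast_sub Nat.one_le_two_pow]; push_cast; ring
  rw [hc]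
  push_cast
  rw [pow_succ]
  have h2 : (0 : ℝ) < 2 ^ j := by positivity
  field_simp
  ring

/-- Dyadic decomposition of `[2^8, 2^{J+1})`. [folklore] -/
theorem sum_Ico_dyadic (f : ℕ → ℝ) : ∀ J, 8 ≤ J →
    ∑ x ∈ Ico (2 ^ 8) (2 ^ (J + 1)), f x = ∑ j ∈ Icc 8 J, ∑ x ∈ Ico (2 ^ j) (2 ^ (j + 1)), f x := by
  refine Nat.le_induction (by rw [Finset.Icc_self, Finset.sum_singleton]) fun J hJ ih => ?_
  rw [Finset.sum_Icc_succ_top (by omega), ← ih,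
    Finset.sum_Ico_consecutive _ (Nat.pow_le_pow_right two_pos (by omega))
      (Nat.pow_le_pow_right two_pos (by omega))]

/-! ### §11 Assembly -/

/-- The global majorant: table for `x ≤ 255`, far-range value `V(⌊log₂ x⌋)` beyond. [folklore] -/
noncomputable def Umaj (x : ℕ) : ℝ := if x ≤ 255 then ((uQ x : ℚ) : ℝ) else farV (Nat.log 2 x)

/-- `E_X(x) ≤ U(x)` for every `x ≥ 1` and every `X`. [cite: HeathbrownPuchta2002, §5 (41)] -/
theorem sum_filter_le_Umaj (s : Finset ℕ) {x : ℕ} (hx1 : 1 ≤ x) :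
    ∑ t ∈ s with ordTwo t ≤ x, fq 1 t ≤ Umaj x := by
  by_cases h255 : x ≤ 255
  · rw [Umaj, if_pos h255]
    by_cases h60 : x ≤ 60
    · rw [uQ, if_pos h60]; exact head_U s hx1 h60
    · rw [uQ, if_neg h60]; exact table_bound s x
  · rw [Umaj, if_neg h255]
    push Not at h255
    exact sum_filter_ordTwo_le_farV s (Nat.le_log_of_pow_le one_lt_two (by omega))
      (Nat.lt_pow_succ_log_self one_lt_two x)

/-- `∑_{x=1}^{255} U(x)/(x(x+1)) ≤ 1.988156` (from the kernel sum). [folklore] -/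
theorem sum_head_table_le : ∑ x ∈ Icc 1 255, Umaj x / ((x : ℝ) * (x + 1)) ≤ ((HTupQ : ℚ) : ℝ) := by
  have hU : ∀ x ∈ Icc 1 255, Umaj x / ((x : ℝ) * (x + 1)) = ((termQ x : ℚ) : ℝ) := by
    intro x hx
    have : x ≤ 255 := (Finset.mem_Icc.1 hx).2
    rw [Umaj, if_pos this, termQ]; push_cast; ring
  have hQ : ∑ x ∈ Icc 1 255, termQ x ≤ HTupQ := by
    have hL : ∀ (f : ℕ → ℚ) (n : ℕ), ((List.range n).map f).sum = ∑ i ∈ Finset.range n, f i := by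
      intro f n
      induction n with
      | zero => simp
      | succ n ih => rw [List.range_succ, List.map_append, List.sum_append, ih, Finset.sum_range_succ]; simp
    have h := htSum_ok
    rw [hL] at h
    have e : Icc 1 255 = Ico 1 256 := by ext x; simp only [Finset.mem_Icc, Finset.mem_Ico]; omega
    rw [e, Finset.sum_Ico_eq_sum_range]
    refine le_of_eq_of_le (Finset.sum_congr rfl fun i _ => by rw [add_comm]) h
  rw [Finset.sum_congr rfl hU, ← Rat.cast_sum]
  exact_mod_cast hQ

/-- **Uniform bound for the partial sums**: `∑_{t<X} f₁(t)/ξ(t) ≤ 2.071` for every `X`.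
[cite: HeathbrownPuchta2002, §5 (41)] -/
theorem sum_range_fq_div_ordTwo_le_cert (X : ℕ) :
    ∑ t ∈ Finset.range X, fq 1 t / (ordTwo t : ℝ) ≤ 2.071 := by
  -- dyadic ceiling `X ≤ X' = 2^{J+1} − 1`, `J ≥ 8`
  obtain ⟨J, hJ8, hXlt⟩ : ∃ J, 8 ≤ J ∧ X < 2 ^ (J + 1) :=
    ⟨max 8 (Nat.log 2 X), le_max_left _ _,
      (Nat.lt_pow_succ_log_self one_lt_two X).trans_le (Nat.pow_le_pow_right two_pos (by omega))⟩
  have hX'1 : 2 ^ (J + 1) - 1 + 1 = 2 ^ (J + 1) := Nat.sub_add_cancel Nat.one_le_two_pow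
  have h512 : 2 ^ 9 ≤ 2 ^ (J + 1) := Nat.pow_le_pow_right two_pos (by omega)
  have hJJ : 2 ^ J ≤ 2 ^ (J + 1) - 1 := by rw [pow_succ] at hX'1 ⊢; omega
  set X' := 2 ^ (J + 1) - 1 with hX'def
  have hXX' : X ≤ X' := by omega
  have h256 : 256 ≤ X' := by omega
  have hnn : ∀ t, 0 ≤ fq 1 t / (ordTwo t : ℝ) := fun t => div_nonneg (fq_nonneg 1 t) (Nat.cast_nonneg _)
  have hmono : ∑ t ∈ Finset.range X, fq 1 t / (ordTwo t : ℝ) ≤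
      ∑ t ∈ Finset.range X', fq 1 t / (ordTwo t : ℝ) :=
    Finset.sum_le_sum_of_subset_of_nonneg (Finset.range_mono hXX') fun t _ _ => hnn t
  refine hmono.trans ?_
  have hmaj := sum_range_fq_div_ordTwo_le_of_majorant Umaj (X := X') (by omega)
    fun x hx => sum_filter_le_Umaj _ (Finset.mem_Icc.1 hx).1
  refine hmaj.trans ?_
  -- split `[1, X'] = [1, 255] ∪ [2^8, 2^{J+1})`
  have hsplit : ∑ x ∈ Icc 1 X', Umaj x / ((x : ℝ) * (x + 1)) =
      ∑ x ∈ Icc 1 255, Umaj x / ((x : ℝ) * (x + 1)) +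
        ∑ x ∈ Ico (2 ^ 8) (2 ^ (J + 1)), Umaj x / ((x : ℝ) * (x + 1)) := by
    have h1 : Icc 1 X' = Icc 1 255 ∪ Ico (2 ^ 8) (2 ^ (J + 1)) := by
      ext x; simp only [Finset.mem_Icc, Finset.mem_union, Finset.mem_Ico]; omega
    rw [h1, Finset.sum_union]
    rw [Finset.disjoint_left]
    intro x h1 h2
    simp only [Finset.mem_Icc, Finset.mem_Ico] at h1 h2
    omega
  -- the far blocks
  have hblock : ∀ j ∈ Icc 8 J, ∑ x ∈ Ico (2 ^ j) (2 ^ (j + 1)), Umaj x / ((x : ℝ) * (x + 1)) =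
      farV j / 2 ^ (j + 1) := by
    intro j hj
    have hj8 : 8 ≤ j := (Finset.mem_Icc.1 hj).1
    have h28 : 2 ^ 8 ≤ 2 ^ j := Nat.pow_le_pow_right two_pos hj8
    have hU : ∀ x ∈ Ico (2 ^ j) (2 ^ (j + 1)), Umaj x / ((x : ℝ) * (x + 1)) =
        farV j * (1 / ((x : ℝ) * (x + 1))) := by
      intro x hx
      have hx' := Finset.mem_Ico.1 hx
      have : ¬ x ≤ 255 := by omega
      rw [Umaj, if_neg this, Nat.log_eq_of_pow_le_of_lt_pow hx'.1 hx'.2]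
      ring
    rw [Finset.sum_congr rfl hU, ← Finset.mul_sum, sum_Ico_block]
    ring
  have hlast : Umaj X' / ((X' : ℝ) + 1) = farV J / 2 ^ (J + 1) := by
    have : ¬ X' ≤ 255 := by omega
    rw [Umaj, if_neg this, Nat.log_eq_of_pow_le_of_lt_pow hJJ (by omega)]
    have hc : (X' : ℝ) + 1 = (2 : ℝ) ^ (J + 1) := by
      rw [hX'def, Nat.cast_sub Nat.one_le_two_pow]; push_cast; ring
    rw [hc]
  have hfar : ∑ x ∈ Ico (2 ^ 8) (2 ^ (J + 1)), Umaj x / ((x : ℝ) * (x + 1)) + Umaj X' / ((X' : ℝ) + 1) ≤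
      ((A1Q : ℚ) : ℝ) * TjR 8 := by
    rw [sum_Ico_dyadic _ J hJ8, Finset.sum_congr rfl hblock, hlast]
    have hA0 : 0 ≤ ((A1Q : ℚ) : ℝ) := by
      have := farV_le hJ8
      have hV : 0 ≤ farV J := by
        have := sum_filter_ordTwo_le_farV (∅ : Finset ℕ) (x := 2 ^ (J + 1) - 1) hJ8 (by omega)
        simpa using this
      have hg : 0 < gfun J := by
        rw [gfun]
        have : (17 : ℝ) ≤ ((2 * J + 1 : ℕ) : ℝ) := by exact_mod_cast (show 17 ≤ 2 * J + 1 by omega)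
        exact mul_pos (by linarith) (by nlinarith)
      nlinarith
    have h1 : ∑ j ∈ Icc 8 J, farV j / 2 ^ (j + 1) ≤ ((A1Q : ℚ) : ℝ) * ∑ j ∈ Icc 8 J, gfun j / 2 ^ (j + 1) := by
      rw [Finset.mul_sum]
      refine Finset.sum_le_sum fun j hj => ?_
      rw [mul_div_assoc']
      exact div_le_div_of_nonneg_right (farV_le (Finset.mem_Icc.1 hj).1) (by positivity)
    have h2 : farV J / 2 ^ (J + 1) ≤ ((A1Q : ℚ) : ℝ) * (gfun J / 2 ^ (J + 1)) := by
      rw [mul_div_assoc']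
      exact div_le_div_of_nonneg_right (farV_le hJ8) (by positivity)
    have h3 := gfun_div_le_TjR J
    calc _ ≤ ((A1Q : ℚ) : ℝ) * ∑ j ∈ Icc 8 J, gfun j / 2 ^ (j + 1) + ((A1Q : ℚ) : ℝ) * (gfun J / 2 ^ (J + 1)) :=
          add_le_add h1 h2
      _ = ((A1Q : ℚ) : ℝ) * (TjR 8 - TjR (J + 1) + gfun J / 2 ^ (J + 1)) := by rw [sum_gfun J hJ8]; ring
      _ ≤ ((A1Q : ℚ) : ℝ) * TjR 8 := mul_le_mul_of_nonneg_left (by linarith) hA0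
  have hfin : ((HTupQ : ℚ) : ℝ) + ((A1Q : ℚ) : ℝ) * TjR 8 ≤ 2.071 := by
    rw [TjR_eight]
    have h := final_ineq
    have h' : ((HTupQ + A1Q * (121277 / 1600000) : ℚ) : ℝ) ≤ ((2071 / 1000 : ℚ) : ℝ) := by exact_mod_cast h
    push_cast at h'
    linarith
  calc ∑ x ∈ Icc 1 X', Umaj x / ((x : ℝ) * (x + 1)) + Umaj X' / ((X' : ℝ) + 1)
      = ∑ x ∈ Icc 1 255, Umaj x / ((x : ℝ) * (x + 1)) +
          (∑ x ∈ Ico (2 ^ 8) (2 ^ (J + 1)), Umaj x / ((x : ℝ) * (x + 1)) + Umaj X' / ((X' : ℝ) + 1)) := by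
        rw [hsplit, add_assoc]
    _ ≤ ((HTupQ : ℚ) : ℝ) + ((A1Q : ℚ) : ℝ) * TjR 8 := add_le_add sum_head_table_le hfar
    _ ≤ 2.071 := hfin

/-- **Kernel-certified upper bound for Romanov's constant**:
`R₀ = ∑_t f₁(t)/ord_t 2 ≤ 2.071` (print: `1.936 < R₀ < 1.94`, [PintzRuzsa2003, (8.14)]; this bound
is what the `K = 9` assembly of `GoldbachLinnikCertifiedLargeDeviation` consumes, any value `≤ 2.2142` suffices).
[cite: HeathbrownPuchta2002, §5 (41)] -/
theorem romanovConst_le : romanovConst ≤ 2.071 :=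
  Real.tsum_le_of_sum_range_le (fun t => div_nonneg (fq_nonneg 1 t) (Nat.cast_nonneg _))
    sum_range_fq_div_ordTwo_le_cert


end GoldbachLinnik

end Literature.NumberTheory.Sieve
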